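import Summits.ResolutionOfSingularities.ResolutionOfSingularities.Theses.FrobeniusClosing
import Summits.ResolutionOfSingularities.ResolutionOfSingularities.Theorems.ValuativeLuAlphaPTorsorKnownRanges
import Summits.ResolutionOfSingularities.ResolutionOfSingularities.Theorems.ValuativeLuAlphaPTorsorDimTwoCorollaries
import Summits.ResolutionOfSingularities.ResolutionOfSingularities.Theorems.ValuativeLuAlphaPTorsorDiscreteAllDim
import Summits.ResolutionOfSingularities.ResolutionOfSingularities.Theorems.ValuativeLuAlphaPTorsorDenseRangeFinal
import Summits.ResolutionOfSingularities.ResolutionOfSingularities.Theorems.ValuativeLuAlphaPTorsorChartRegular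
import Literature.AlgebraicGeometry.Resolution.QuadraticTransforms
import Literature.AlgebraicGeometry.Resolution.RsopMonomialIdeals
import Summits.ResolutionOfSingularities.ResolutionOfSingularities.Theorems.FrobeniusClosingSteerZeroDimPerfect
import Summits.ResolutionOfSingularities.ResolutionOfSingularities.Theorems.FrobeniusClosingSteerSwitchingDefectless
import Summits.ResolutionOfSingularities.ResolutionOfSingularities.Theorems.FrobeniusClosingSteerCore4RunTrichotomy
import Summits.ResolutionOfSingularities.ResolutionOfSingularities.Theorems.FrobeniusClosingSteerCore4OrderOneExit
import Summits.ResolutionOfSingularities.ResolutionOfSingularities.Theorems.FrobeniusClosingSteerCore4Dictionary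
import Summits.ResolutionOfSingularities.ResolutionOfSingularities.Theorems.FrobeniusClosingSteerCore4LowMultTwo
import HarnessLib
import Summits.ResolutionOfSingularities.ResolutionOfSingularities.Theorems.FrobeniusClosingSteerCore4GenExit
import Summits.ResolutionOfSingularities.ResolutionOfSingularities.Theorems.FrobeniusClosingSteerMaxGenExists
import Summits.ResolutionOfSingularities.ResolutionOfSingularities.Theorems.FrobeniusClosingSteerCore4CompositeRankConcl
import Literature.AlgebraicGeometry.Resolution.ResolutionOfSingularitiesProofs
import Literature.AlgebraicGeometry.Resolution.ResolutionLU
import Literature.AlgebraicGeometry.CossartPiltant200819.TowerInheritance2008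
import Summits.ResolutionOfSingularities.ResolutionOfSingularities.Theorems.WildConesIsolatedForcedTermination

/-!
# Crux `Steer` (stmt-ResolutionOfSingularities-16345) — line `switching-dichotomy`, reshape r19 (lead res-L0-w41-lead-1 g3)

**r19 (2026-08-27).** CHARACTERISTIC SPLIT of the live R2 residual (plan-1 g7's Sketch-R2-recut v2
42fceeb46e145bfe §6 verbatim; WORD 04:57:11Z): registered `stub_R2FourRankOneTwo : R2FourRankOneTwo` (p = 2, n = 4, rank one —
the σ-steered composition's target, to be DERIVED from X p497302 + E + σ-residual names at the next boundary) and ONE parked name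
`stub_R2OddHigh : R2OddHigh := R2FourRankOneOdd ∧ R2High`; `stub_R2FourRankOne` / `stub_R2High` DERIVED. Registered stubs (7):
`stub_cp2019General` · `stub_logFinalExitM` · `stub_eternalStallPhaseSSL` · `stub_eternalAlternationSSL` · `stub_nonSwitchingCore` ·
`stub_R2FourRankOneTwo` · `stub_R2OddHigh`.

**r18 (2026-08-27).** One binder, at the working seat's request (res-L0-w41-stub-9, 04:58:27Z): `LogFinalExitM` gains
`ZeroDim k O →` after `A₁.toSubring ≤ O.toSubring` (closed centre ⇒ perfect residue field ⇒ Kunz `p`-basis); the derived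
member form `stub_logExit` supplies it from `CoreDatum`. Nothing else changes; registered stubs as in r17 (7).

**r17 (2026-08-27).** THE R2 RE-CUT ADOPTED (chain planner res-L0-w41-plan-1 g7's `Sketch-R2-recut.lean` fc3184e97514f93e §4
VERBATIM, CHAIN v5.4 §B2): the registered r8/r12 residual `Sig.stub_core4EternalNonIsolated` (R2) is DERIVED
(`core4EternalNonIsolated_of_pieces`) from the fact debt `stub_cp2019General` (composite rank at `n = 4`, idea-1's p493665)
and two NEW registered stubs: `stub_R2FourRankOne : R2FourRankOne` (n = 4 ALONG A VALUATION RING WITHOUT PROPER COARSENING —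
rank one: THE LIVE R2 RESIDUAL; no inhabitant of essential dimension 4 on record) and `stub_R2High : R2High` (n ≥ 5, R2
verbatim, PARKED). Plan-1's §5 bridge `NotCoarseningArchSeq` is PROVED in-skeleton (`notCoarseningArchSeq`, from r16's
`exists_pow_lt_of_rankOne`). Registered stubs after r17 (sorries 7 = stubs_max): `stub_cp2019General` (FACT DEBT) ·
`stub_logFinalExitM` (DISCHARGEABLE, staffed: stub-9, stub-6, stub-5, stub-3, stub-1) · `stub_eternalStallPhaseSSL` (Φ3ᴸˢ) ·
`stub_eternalAlternationSSL` (Φ4ᴸˢ) · `stub_nonSwitchingCore` · `stub_R2FourRankOne` · `stub_R2High`. Every frontier stub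
now carries the map of record «at n = 4 the valuation has rank one»; R1's `stub_core4LowMultOdd` and R2's
`stub_core4EternalNonIsolated` are both theorems of the registered residue.

**r16 (2026-08-27).** (i) The dischargeable log-final stub is RE-KEYED to the statement actually being proved: registered
`stub_logFinalExitM : ∀ p, LogFinalExitM p` = res-L0-w41-idea-2 g3's MODEL FORM verbatim (`Sketch-idea-2c.lean` v3
1866cc8b286caf08; staffed by res-L0-w41-stub-9 (E1), -stub-6 (degree-`p` transfer p497399, E2), -stub-5 (`[F : F^p] = p^n`),
plan `L/res-L0-w41-idea-2/PLAN-LogFinalExitM.md`), and the member form `stub_logExit : LogExit` is DERIVED in-skeleton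
(`GenRebase` at `s' := t` + `sequence_le_subfield`), so their landing closes the stub by a definitional `exact`; (ii) the
(α) heart at `n = 4` is made kernel-visible: `archSeq_and_defect_of_not_hasProperCoarsening` — a core datum that is strongly
switching along a valuation ring without proper coarsening has RANK ONE (idea-1's `rankOne_of_not_hasProperCoarsening`),
hence is parameter-archimedean (`exists_pow_lt_of_rankOne` from the tree's `CP2008.nonempty_rankOne_iff_archimedean` +
`Theorems.SwitchingDichotomy.archSeq_of_arch`), hence has DEFECT by the core binder: the registered Φ3ᴸˢ/Φ4ᴸˢ at `n = 4`
are statements about rank-one defect extensions of degree `p`. Registered stubs after r16 (sorries 6): `stub_cp2019General`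
(debt) · `stub_logFinalExitM` (dischargeable, staffed) · `stub_eternalStallPhaseSSL` · `stub_eternalAlternationSSL` ·
`stub_nonSwitchingCore` · `stub_core4EternalNonIsolated`.

**r15 (2026-08-27).** THE MAP OF RECORD AT `n = 4` PUT INTO THE KERNEL (CHAIN v5.2 §A1 (γ): «rank ≥ 2 at n = 4 is FACT
DEBT via res-L0-w41-idea-1's `concl_of_hasProperCoarsening` ⇐ `CossartPiltant2019General`; live core at n = 4 = RANK
ONE»). (i) The fact debt is RE-BASED: the registered debt stub is now `stub_cp2019General : Sig.stub_cp2019General`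
(= `Literature.….CossartPiltant2019General`, Cossart–Piltant 2019 Thm. 1.1 as printed), from which the tree derives
`CossartPiltant2019` (`CossartPiltant2019General.cossartPiltant2019'`, with `Matsumura1987_32_polynomial_holds`) and
`CossartPiltant2019LU3` (`CossartPiltant2019.lu3`), so `stub_lu3Perfect` is DERIVED; (ii) the composition
`concl_of_phasesSSL` first splits off `n = 4 ∧ HasProperCoarsening O` and concludes there by idea-1's LANDED
`Theorems.SteerRankThinness.concl_of_hasProperCoarsening` (p493179/p493665; `Concl` verbatim) from the same debt; (iii)
the three R1-side frontier stubs `stub_eternalStallPhaseSSL`, `stub_eternalAlternationSSL`, `stub_nonSwitchingCore` (and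
the recorded strong form `SeqLogFinalSS`) gain the hypothesis `n = 4 → ¬ HasProperCoarsening O` (at `n = 4` the valuation
has rank one, `Theorems.SteerRankThinness.rankOne_of_not_hasProperCoarsening`). `Sig.stub_core4EternalNonIsolated` (R2)
is left verbatim (its sub-plan pieces X / E are being landed against it by res-L0-w41-stub-7 and -stub-8). Registered stubs after
r15 (sorries 6): `stub_cp2019General` (FACT DEBT) · `stub_logExit` (P1ᴸ, dischargeable) · `stub_eternalStallPhaseSSL`
(Φ3ᴸˢ) · `stub_eternalAlternationSSL` (Φ4ᴸˢ) · `stub_nonSwitchingCore` · `stub_core4EternalNonIsolated` (R2).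

**r14 (2026-08-27).** P0 `stub_maxGenExists` DISCHARGED in-skeleton by res-D-pv-004 (AS res-L0-w41-stub-10)'s landed
`Theorems/FrobeniusClosingSteerMaxGenExists.lean` (p496225: `MaxGenExists.exists_isMaxGenAt_of_sequence` — every member
`R M` is `(A₁)_{𝔪_O ∩ A₁}` for a finitely generated model, Noetherian with finite integral closure in `K` (Liu 2002 Prop.
4.1.27), so a maximal simple order containing `t` exists by ACC). Registered stubs after r14 (sorries 6): `stub_lu3Perfect`
(debt) · `stub_logExit` (P1ᴸ, dischargeable; rows stub-9 E1 / stub-6 degree-`p` transfer for E2) · `stub_eternalStallPhaseSSL`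
(Φ3ᴸˢ) · `stub_eternalAlternationSSL` (Φ4ᴸˢ) · `stub_nonSwitchingCore` · `stub_core4EternalNonIsolated` (R2). r13 text below.

**r13 (2026-08-27).** The R1-odd frontier stub `stub_core4LowMultOdd` of r12 is DERIVED from the chain planner's PHASE
MACHINE (res-L0-w41-plan-1 g6, typed sub-plan `L/w41/Sketch-R1-phases.lean` v3 sha16 c42bbe8866b20dc2, CHAIN v5.1 §A /
v5.2 §A1 / v5.3 §A): at every member `S = R M` of the point sequence of the base along `O` read ALL generators `s'` of
simple `S`-orders containing `t` (`GenAt`), maximal ones (`IsMaxGenAt`) deciding the stage type — exit (`ExitAt`, some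
generator in order-one form), multiplicity-`p` re-entry (`MultPAt`, some maximal generator takes a strict-transform step)
or stall (`StallAt`) —, and log-final members (`LogExitAt`, idea-2's E1/E2). Classical case split at one core datum
(`concl_of_phasesSSL`, kernel-checked): not strongly switching ⇒ `NonSwitchingCore`; a log-final member ⇒ P1ᴸ `LogExit`;
an exit stage ⇒ P1 `GenExit`; an eternal affine run from some generator at some stage ⇒ re-base there (P2⁰ `GenRebase`)
and EITHER a landed range concludes for the re-based datum OR it is again a core datum (`concl_or_coreDatum` = the landed
range cascade of `Steer_of` as a lemma) with an eternal run, non-isolated infinitely often by the LANDED dictionary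
(`stub_core4Dictionary`, consuming the CLOSED door `IsolatedForcedTermination_proof` p459384), hence `Concl` by the
registered R2; a quiet tail ⇒ Φ3ᴸˢ `EternalStallPhaseSSL` (P0 `MaxGenExists` supplying maximal generators); otherwise the
hypotheses of Φ4ᴸˢ `EternalAlternationSSL` hold literally.

HOLDER'S ONE DEVIATION from the sub-plan: its piece `Rebase` (re-base at a generator that CAN STEP, transferring all
fourteen core binders — `IsMaximal`, `¬ dim ≤ 2`, `hδ`, `hc`, … — to the new model) is REPLACED by the weaker `GenRebase`
(re-base at ANY generator: model, `locAtCentre A' O = R M`, `s' ^ p ∈ A'`, `t ∈ A'[s']`, `Frac = K`, regular at the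
centre, push-down of `Concl`; no step hypothesis, no binder transfer), because the composition recovers the binders of the
re-based datum — or `Concl` outright — from the landed range cascade. `GenRebase` and `GenExit` are DISCHARGED in this
reshape by the lead's landed Theses-free helper `Theorems/FrobeniusClosingSteerCore4GenExit.lean`
(`Theorems.SwitchingDichotomy.genRebase` / `genExit`: `exists_model_of_sequence_member` + one common unit denominator +
`isRegularLocalRing_sequence`; `orderOneExit` p479657 at `N = 0` along `i ↦ R (M + i)`).

Registered stubs after r13 (sorries 7 = stubs_max; two of them dischargeable and staffed by CHAIN v5.3's arrival table):
`stub_lu3Perfect` (FACT DEBT, `CossartPiltant2019LU3`) · `stub_maxGenExists` (P0, DISCHARGEABLE M–L: finiteness of the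
integral closure of `R M` in `K` + ACC; row res-L0-w41-stub-10) · `stub_logExit` (P1ᴸ, DISCHARGEABLE M: idea-2's
`LogFinalExitM` at a member, E1 via the named fact F-E1 `Posva2023_Lemma_2_37_rank1` p491440; row res-L0-w41-stub-9) ·
`stub_eternalStallPhaseSSL` (Φ3ᴸˢ, FRONTIER) · `stub_eternalAlternationSSL` (Φ4ᴸˢ, FRONTIER) · `stub_nonSwitchingCore`
(FRONTIER with a plan: idea-2's `FoliationLUR1M` + `LogFinalExitM` on rank one, idea-1's `concl_of_hasProperCoarsening`
p493179 ⇐ `CossartPiltant2019General` on rank ≥ 2 at `n = 4`) · `stub_core4EternalNonIsolated` (R2, FRONTIER; typed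
sub-plan `Sketch-R2-steered.lean` NOT adopted — one phase machine, CHAIN v5.1 §A4). Discharged in-skeleton, by name:
`stub_zeroDimPerfect` p166845, `stub_switchingDefectless` p169091, `stub_core4RunTrichotomy` p473559,
`stub_core4OrderOneExit` p479657, `stub_core4Dictionary` p483380, `stub_core4LowMult` at `p = 2` p481401, `genExit_holds` /
`genRebase_holds` (this reshape). The three frontier Φ/NS residuals + R2 are `DimensionFourFrontier` territory with NO
inhabitant of Φ3ᴸˢ/Φ4ᴸˢ on record (idea-2's `W_far` and tri-2's re-entry datum are not strongly switching). OURS; nothing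
here is a statement of the manuscript [claim: Hironaka2017, status: under-review].

# (r12 header, kept) Crux `Steer` (stmt-ResolutionOfSingularities-16345) — line `switching-dichotomy`, reshape r12 (lead res-L0-w41-lead-1)

**r12 (2026-08-27).** R1 split by parity (stub-2's candidate, CHAIN v4.4 §B): `stub_core4LowMult` is DERIVED from the landed
`LowMult.core4LowMult_two` (p481401: at `p = 2` the stall regime `2 ≤ ν < p` is empty) and the NEW registered frontier stub
`stub_core4LowMultOdd` (`p ≠ 2`). Registered stubs after r12: `stub_lu3Perfect` (fact debt), `stub_core4LowMultOdd` (R1, odd `p`),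
`stub_core4EternalNonIsolated` (R2) — sorries 3, and every registered residue is a genuinely open statement.

# (r11 header, kept)

**r11 (2026-08-27).** `stub_core4Dictionary` DISCHARGED in-skeleton: the valuation-run dictionary is a THEOREM of the tree
(`Theorems/FrobeniusClosingSteerCore4Dictionary.lean`, composing the leaf `…DictionaryRun/Leaf/OfChartStep` with
`ChartZero.chart_zero` (T1), `ChartStep.chart_step` (T2), `Isol.isol_transfer` (I), `order_le_of_X_pow_dvd_subst` (S)).
`IsolatedForcedTermination` is now CONSUMED in the kernel, not idle (Disproof §5 answered). Registered stubs after r11: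
`stub_lu3Perfect` (fact debt: LU in dimension ≤ 3 over perfect fields, Cossart–Piltant), `stub_core4LowMult` (R1:
multiplicity `2 ≤ ν < p` stall; empty at `p = 2`), `stub_core4EternalNonIsolated` (R2: eternal run, non-isolated
infinitely often) — sorries 3; the two frontier residues are `DimensionFourFrontier` verbatim.

# (r10 header, kept)

**r10 (2026-08-27).** `stub_core4OrderOneExit` DISCHARGED in-skeleton by res-L0-w41-stub-3's landed `orderOneExit`
(p479657); the leaf of `stub_core4Dictionary` is LANDED CONDITIONAL on the four Theses-free dictionary helpers
(`Theorems/FrobeniusClosingSteerCore4DictionaryRun.lean` p480356, `…DictionaryLeaf.lean` p480959: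
`Core4Dictionary.stub_core4Dictionary_of_dict : T1 → T2 → I → S → Sig.stub_core4Dictionary`), of which T1 (p478399),
I (p479356) and S (`…Core4IsoOrderBound`) are in the tree and T2 `chart_step` is in progress (stub-1: p-ids of
`…ChartStepLift/Point`). Registered stubs after r10: `stub_lu3Perfect` (debt), `stub_core4Dictionary` (closing),
`stub_core4LowMult` (R1), `stub_core4EternalNonIsolated` (R2) — sorries 4.

# (r9 header, kept)

**Reshape r9 (lead `res-L0-w41-lead-1`, 2026-08-27; supersedes the lead's r8 sha 24bb2199 of 2026-08-26T22:45Z).** r8 cut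
r7's core `stub_steerDefectCore4` into `stub_core4Iso` (no eventually-isolated multiplicity-`p` radicand chain
along `O`; dischargeable from the antecedent by the valuation-run dictionary) and `stub_core4NonIso` (the residual).
The chain planner's finer typed sub-plan (`L/w41/line-switching_dichotomy-r8.lean`, sha fca30952; CHAIN v3.1: «same
mathematics, coarser registration») is ADOPTED here verbatim as the registered cut, because (i) its five pieces compose
to the r7 core by PURE LOGIC (`stub_steerDefectCore4_of`, no bridge lemmas), (ii) the frontier residues get
registered NAMES (`stub_core4LowMult` = R1, `stub_core4EternalNonIsolated` = R2) that ideation / critic / K4.1c seats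
key on, and (iii) `stub_core4RunTrichotomy` is ALREADY LANDED by name and signature (res-L0-w41-stub-2, p473559,
`Theorems/FrobeniusClosingSteerCore4RunTrichotomy.lean`) and is discharged below in-skeleton. Correspondence: lead r8
`stub_core4Iso` = `stub_core4Dictionary` read contrapositively (an eternal torsor run IS a radicand chain with
multiplicity `p` at every stage: `s i = x * s (i+1) + g ⇔ (s (i+1))^p = ((s i)^p - g^p)/x^p`); lead r8 `stub_core4NonIso`
⊇ {`stub_core4OrderOneExit`, `stub_core4LowMult`, `stub_core4EternalNonIsolated`} via `stub_core4RunTrichotomy`. The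
dictionary helpers behind `stub_core4Dictionary` (lead's `DICT-SIGS.lean`: T1 `chart_zero`, T2 `chart_step`, I
`isol_transfer`, M `multP_transfer`; stub-1's landed `FormalTorsorLemmas` p473056 = derivations of `κ⟦X⟧` are partials +
cleaning lemmas) are vocabulary-agnostic (formal charts `R i →+* κ⟦X⟧` with constant coefficients = residues of `O`
and the centre generating `(X)`) and land as Theses-free helpers; the leaf `Theorems/FrobeniusClosingSteerCore4Dictionary.lean`
(lead) proves `stub_core4Dictionary` from them, `Theorems.WildCones.MuDropCharTwoOrdP.X_pow_mul_serT_eq_subst` and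
`IsolatedForcedTermination_proof`. Registered stubs after r9: `stub_lu3Perfect` (fact debt), `stub_core4Dictionary`
(dischargeable, XL), `stub_core4OrderOneExit` (provable, S/M), `stub_core4LowMult` (frontier R1), `stub_core4EternalNonIsolated`
(frontier R2) — sorries 5; `stub_core4RunTrichotomy` is a theorem. OURS; nothing here is a statement of the manuscript.

# (chain planner's r8 header, kept)

Route `ResolutionOfSingularities/FrobeniusClosing`, crux #3 (shared verbatim with `WildCones`, `JacobianBudget`,
`EscapeRate`): `Steer = IsolatedForcedTermination → ∀ p prime, TorsorLU p` (torsor LU = local uniformization of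
`α_p`-torsors `t ^ p = a` over bases regular at the centre, along every valuation, over every PERFECT
ground field; verbatim the body of `TorsorLUPerfect`, stmt-16158).

History. Strategist skeleton (sha 450bd9bb…, 4 stubs); lead -0 reshapes r1–r5 (2026-08-17): the standing
disprover's `Arch` repair (Disproof.lean §6 (d)), the TRUE `L` lemma `stub_switchingDefectless` cut into
worker stubs and LANDED — `stub_zeroDimPerfect` p166845, `stub_switchingSetup` p166601, `stub_rsopMonomialStep`
p167176, `stub_switchingExit` p166891, `stub_switchingAssembly` p167646, `stub_switchingAssemblySeq` p168347,
range theorems `switchingDefectless` / `switchingDefectlessSeq` p169091 (strongly switching ∧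
parameter-archimedean ∧ defectless ⇒ torsor LU, every dimension, any ground field of characteristic `p`).
r5 left TWO open stubs, `stub_switchingDefect` (SS ∧ ArchSeq ∧ Defect) and `stub_alongPrimeTransfer`
(¬ (SS ∧ ArchSeq)) — together the open core.

**Reshape r6 (lead -c1).** The parent crux `Valuative.LuAlphaPTorsor` (stmt-0641, all ground
fields) has meanwhile been reduced by its own line to ONE registered stub, the DEFECT CORE F⁹
(`Cruxes/LuAlphaPTorsor/Lines/pfaff_line_log_final_forms.lean`, `luAlphaPTorsor_iff_defectCoreFinal`), and
every other case is a LANDED theorem importable here: the birational exit (`stub_birationalExit`: `t ^ p`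
a `p`-th power at the centre), base dimension `≤ 2` at the centre (`luAlphaPTorsor_of_ringKrullDim_le_two`,
Giraud along `ν`), a unit `ℤ`-derivative of the radicand (`luAlphaPTorsor_of_isUnit_derivation`, monogenic
exit), and the dense-Abhyankar range of Knaf–Kuhlmann 2009 Thm. 1.5 along zero-dimensional valuations with
NO separability hypothesis (`denseRange3_crux`). r6 discharges all of them inside `Steer_of`, next to the
three ranges already used (trdeg `≤ 2`, Abhyankar places over perfect `k`, discrete rank one) and this
line's own landed range (strongly switching ∧ parameter-archimedean ∧ defectless), and MERGES the two r5
stubs into ONE open stub `stub_steerDefectCore` = F⁹ restricted to PERFECT ground fields, intersected with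
`¬ (StronglySwitching ∧ ArchSeq ∧ ¬ Defect)`, and handed the antecedent `IsolatedForcedTermination`, the
transcendence degree `n ≥ 3` and torsor LU at all zero-dimensional valuations in transcendence degree `< n`
(the induction hypothesis generated by `Steer_of`). Sorries 2 → 1; the residual of `Steer` is now literally
a sub-case of the parent's registered residual F⁹ — one open core for the whole LU family instead of three
differently phrased ones. `Steer` is EQUIVALENT to this core (`Steer_iff_steerDefectCore` below; landed as
`Theorems/FrobeniusClosingSteerDefectCore.lean`).

**Reshape r7 (lead -c2, this file).** The r6 core asked for the conclusion in every transcendence degree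
`n ≥ 3`. But `n = 3` is KNOWN IN PRINT: local uniformization in dimension `3` (Cossart–Piltant 2008/2009 over fields
differentially finite over a perfect field — the purely inseparable case `h = X ^ p + f` of their Main Theorem is
literally this slice along rank-one valuations —; Cossart–Piltant 2019 Thm. 1.1 with §4.1 (LU) over every field), in
the tree as the NAMED FACT `LocalUniformization3 k` / `CossartPiltant2019LU3` (unproved there: a formalization debt,
not an open problem). r7 therefore CUTS THE CORE AT THE PRINT FRONTIER: the new stub `stub_lu3Perfect` (LU in
dimension `≤ 3` over perfect fields of characteristic `p`; one line from `CossartPiltant2019LU3`) discharges `n = 3`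
through `LocalUniformization3.relLocalUniformization` and `exists_regularModel_of_relLocalUniformization`, and the
ONLY open stub `stub_steerDefectCore4` is the r6 core with `4 ≤ n` — verbatim an instance of
`Literature.Barriers.ResolutionOfSingularities.DimensionFourFrontier` (local uniformization in dimension `≥ 4` in
positive characteristic). Sorries 1 → 2, but of different kinds: one fact debt (published theorem), one open problem;
`Steer` is equivalent to the dimension-`≥ 4` core GIVEN the fact (`Steer_iff_steerDefectCore4_of_lu3`, landed as
`Theorems/FrobeniusClosingSteerDefectCore4.lean`).

**Reshape r8 (W4.1 crux planner `res-L0-w41-plan-1`, the C2 cut; this file).** r7's only open stub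
`stub_steerDefectCore4` received the antecedent `hT : IsolatedForcedTermination` but no argument on record
USES it (Disproof.lean §5: `hT` is logically idle unless the `p`-adic cleaning run of the radicand along `O` is
read as the typed point dynamics of `IsolatedForcedTermination`). r8 builds exactly that reading into the
skeleton. New vocabulary (section `TorsorRun`, over existing declarations only): a TORSOR RUN `s : ℕ → K` of
the datum along the quadratic sequence `R` of the base — `s 0 = t`, `(s i) ^ p ∈ R i`, and the
strict-transform rule `s i = x * s (i + 1) + g` with `g ∈ R i` a `p`-th-power cleaner and `x` an exceptional
parameter of `R i → R (i + 1)` (`IsExcParam`, `IsStrictStep`, `IsTorsorRunUpTo`, `IsTorsorRun`); the run CAN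
STEP at stage `N` (`CanStep` ⟺ multiplicity `p` after cleaning, the typed `MultP`); the ORDER-ONE form at a
stage (`OrderOneAt`: after cleaning `(s N) ^ p - g ^ p` is a regular parameter of `R N`); ISOLATION at a stage
(`IsolAt`: the Jacobian ideal `⟨δ f | δ ∈ Der_ℤ (R i)⟩` of `f = (s i) ^ p` is primary to the centre — the typed
`Isol`). The r7 core is CUT into five registered stubs by the behaviour of the greedy run:
`stub_core4RunTrichotomy` (PROVABLE, S/M: the quadratic sequence exists — centre of dimension `≥ 3` — and the
greedy run is eternal, or reaches the order-one form, or stalls at cleaned order in `[2, p - 1]`),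
`stub_core4Dictionary` (PROVABLE, XL — the chain's owned lever: `hT` CONSUMED; an eternal torsor run along a
zero-dimensional `O` over a perfect field is NON-ISOLATED at infinitely many stages; proof = Cohen coordinates
forced by the run, base change to `κ_O^alg`, gauge invariance of `Isol`/`MultP` under `f ↦ w ^ p * f + g ^ p`,
and `hT`), `stub_core4OrderOneExit` (PROVABLE, S/M: the order-one form at stage `N` makes `R N [s N]` regular at
the centre; re-base the datum at stage `N` as in the landed `stub_switchingExit`), and the two FRONTIER-class
residuals `stub_core4LowMult` (the run stalls at cleaned order `2 ≤ ν ≤ p - 1`; empty for `p = 2`;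
`DimensionFourFrontier` for `p ≥ 3`) and `stub_core4EternalNonIsolated` (eternal run, non-isolated at
infinitely many stages — what `hT` leaves of the defect regime). `stub_steerDefectCore4_of` (kernel-checked,
pure logic) recovers `Sig.stub_steerDefectCore4`, so `Steer_of` is unchanged and `Steer_proof` composes the
six registered stubs. Sorries 2 → 6 (1 fact debt, 3 provable, 2 frontier). Pre-triage honoured:
`L/res-L0-w41-tri-1/PRETRIAGE-C2.md` P1 (no re-landing of `Steer ↔ TorsorLUPerfect`, p461266), P2(a) (the
strict-transform update rule is DATA of the run — a run constrained only by `(s i) ^ p ∈ R i` is trivial),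
P2(b) (`hT` restarts at any stage; `Isol` = Jacobian ideal `𝔪`-primary), P3 (residual split R1/R2);
`L/res-L0-w41-tri-2/K41b-SECOND-CHECK.md` (the rank-one defect regime is inhabited, so no vacuous discharge).

Disproof used: `Cruxes/Steer/Disproof.lean` (cdisprove cycle 1): S → C (`steer_of_resolutionOfSingularities`),
`not_steer_iff` / §5 (`hT` carries no logical strength — sibling routes claim the target is a theorem —, so
the core keeps `hT` only as the licence to read the `p`-adic cleaning run as point dynamics), §4 load-bearing
consequent hypotheses (all kept verbatim), §6 (d) the `Arch` repair (kept, in its r4 form `ArchSeq`), §6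
inhabitants of both regimes in trdeg 3 (so the core is not vacuous).
-/

set_option linter.dupNamespace false

open Summit.ResolutionOfSingularities.ResolutionOfSingularities.Theses.FrobeniusClosing
  (Steer IsolatedForcedTermination)
open Summit.ResolutionOfSingularities.ResolutionOfSingularities.Theorems.PfaffLine
open Literature.AlgebraicGeometry.Resolution (IsAbhyankarPlace FGOver exists_ringKrullDim_eq_and_trdeg_eq
  trdeg_eq_trdeg_of_isFractionRing locAtCentre IsQuadraticTransformAlong SubringDominates IsRsopPart
  LocalUniformization3 RelLocalUniformization CossartPiltant2019General)
open Summit.ResolutionOfSingularities.ResolutionOfSingularities.Theorems.SteerRankThinness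
  (HasProperCoarsening concl_of_hasProperCoarsening rankOne_of_not_hasProperCoarsening)

namespace Summit.ResolutionOfSingularities.ResolutionOfSingularities.Cruxes.Steer.Lines.SwitchingDichotomy

/-! ## The consequent of the crux, prime by prime (verbatim line `birth`) -/

/-- Torsor LU over perfect ground fields of characteristic `p` — verbatim the consequent of `Steer`
at `p` (= body of `TorsorLUPerfect`, stmt-16158). [cite: Temkin2013, Rem. 1.3.5] -/
def TorsorLU (p : ℕ) : Prop :=
  ∀ (k K : Type) [Field k] [CharP k p] [PerfectField k] [Field K] [Algebra k K]
    (O : ValuationSubring K) (A₀ : Subalgebra k K) (h₀ : A₀.toSubring ≤ O.toSubring) (t : K),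
    A₀.FG → t ^ p ∈ A₀ → IsFractionRing (Algebra.adjoin k (insert t (A₀ : Set K))) K →
    IsRegularLocalRing (Localization.AtPrime
      (Ideal.comap (Subring.inclusion h₀) (IsLocalRing.maximalIdeal O))) →
    ∃ (A : Subalgebra k K) (h : A.toSubring ≤ O.toSubring), A₀ ≤ A ∧ t ∈ A ∧ A.FG ∧
      IsFractionRing A K ∧ IsRegularLocalRing (Localization.AtPrime
        (Ideal.comap (Subring.inclusion h) (IsLocalRing.maximalIdeal O)))

/-- The same at ZERO-DIMENSIONAL valuation rings (residue field algebraic over `k`), typed as in the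
tree's `relLU_of_relLU_zeroDim` and line `birth`. [cite: ZariskiSamuel1960, Ch. VI §17] -/
def TorsorLUZeroDim (p : ℕ) : Prop :=
  ∀ (k K : Type) [Field k] [CharP k p] [PerfectField k] [Field K] [Algebra k K]
    (O : ValuationSubring K) (A₀ : Subalgebra k K) (h₀ : A₀.toSubring ≤ O.toSubring) (t : K),
    (∀ x ∈ O, ∃ f : Polynomial k, f ≠ 0 ∧ Polynomial.aeval x f ∈ O.nonunits) →
    A₀.FG → t ^ p ∈ A₀ → IsFractionRing (Algebra.adjoin k (insert t (A₀ : Set K))) K →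
    IsRegularLocalRing (Localization.AtPrime
      (Ideal.comap (Subring.inclusion h₀) (IsLocalRing.maximalIdeal O))) →
    ∃ (A : Subalgebra k K) (h : A.toSubring ≤ O.toSubring), A₀ ≤ A ∧ t ∈ A ∧ A.FG ∧
      IsFractionRing A K ∧ IsRegularLocalRing (Localization.AtPrime
        (Ideal.comap (Subring.inclusion h) (IsLocalRing.maximalIdeal O)))

/-! ## Vocabulary of the dichotomy (all over existing declarations) -/

section Vocabulary

variable {k K : Type} [Field k] [Field K] [Algebra k K]

/-- The conclusion of the crux for one datum `(O, A₀, t)`. -/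
def Concl (O : ValuationSubring K) (A₀ : Subalgebra k K) (t : K) : Prop :=
  ∃ (A : Subalgebra k K) (h : A.toSubring ≤ O.toSubring), A₀ ≤ A ∧ t ∈ A ∧ A.FG ∧
    IsFractionRing A K ∧ IsRegularLocalRing (Localization.AtPrime
      (Ideal.comap (Subring.inclusion h) (IsLocalRing.maximalIdeal O)))

variable (k) in
/-- `O` is zero-dimensional over `k`: every element of `O` is a root modulo `𝔪_O` of a non-zero
polynomial over `k` (residue field algebraic over `k`; the closed points of `Zar(K/k)`).
[cite: ZariskiSamuel1960, Ch. VI §17] -/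
def ZeroDim (O : ValuationSubring K) : Prop :=
  ∀ x ∈ O, ∃ f : Polynomial k, f ≠ 0 ∧ Polynomial.aeval x f ∈ O.nonunits

/-- `O` is discrete of rank one (typed as in the landed `luAlphaPTorsor_of_discrete`). -/
def Discrete (O : ValuationSubring K) : Prop :=
  ∃ π : K, π ≠ 0 ∧ O.valuation π < 1 ∧ ∀ z : K, z ≠ 0 → ∃ n : ℤ, O.valuation z = O.valuation π ^ n

variable (k) in
/-- `K` is DENSE (for `v`) in a finitely generated subfield `F₀ ⊇ k` on which `O` is an Abhyankar place
— the hypothesis of the parent crux's landed dense-Abhyankar range `denseRange3_crux`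
(Knaf–Kuhlmann 2009, Thm. 1.5). [cite: KnafKuhlmann2009, Thm. 1.5] -/
def DenseAbhyankar (O : ValuationSubring K) : Prop :=
  ∃ F₀ : Subfield K, (algebraMap k K).fieldRange ≤ F₀ ∧ FGOver (algebraMap k K).fieldRange F₀ ∧
    IsAbhyankarPlace O (algebraMap k K).fieldRange F₀ ∧
    ∀ x w : K, w ≠ 0 → ∃ a ∈ F₀, O.valuation (x - a) < O.valuation w

/-- `x` is a fraction of elements of `A₀` (i.e. `x ∈ Frac A₀ ⊆ K`). -/
def IsFracOf (A₀ : Subalgebra k K) (x : K) : Prop :=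
  ∃ y ∈ A₀, ∃ z ∈ A₀, z ≠ 0 ∧ x = y / z

/-- **Strongly switching (Shannon 1973; Granja 2004; HLOST 2017, Discussion 4.2).** The quadratic
sequence `R 0 = (A₀)_{𝔪_O ∩ A₀} ⊂ R 1 ⊂ ⋯` of the base along `O` EXHAUSTS `O ∩ Frac A₀`: every element
of `O` that is a fraction of elements of `A₀` lies in some `R i` — i.e. the Shannon extension `⋃ R i` is
the valuation ring `O ∩ Frac A₀`. By Shannon / Granja this is the union of the rank-one case ("switches
strongly infinitely often") and the height-one-directed rank-two case.
[cite: arXiv:1505.06445, Discussion 4.2 and Remark 2.4; Shannon1973] -/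
def StronglySwitching (O : ValuationSubring K) (A₀ : Subalgebra k K) : Prop :=
  ∀ R : ℕ → Subring K, R 0 = locAtCentre A₀.toSubring O →
    (∀ i, IsQuadraticTransformAlong O (R i) (R (i + 1))) →
    ∀ x : K, x ∈ O → IsFracOf A₀ x → ∃ i, x ∈ R i

/-- **Parameter-archimedean along the quadratic sequence** (lead reshape r4): every non-zero fraction
`y` of `A₀` of positive value is dominated by a power of a one-element part of a regular system of
parameters of SOME member `R i` of the quadratic sequence of the base along `O`: `v((z 0) ^ n) < v(y)`.
Holds in rank one (`Theorems.SwitchingDichotomy.archSeq_of_arch`) and for height-one-directed sequences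
along an EXCEPTIONAL prime divisor. [cite: HeinzerEtAl2015, Remark 2.4] [folklore] -/
def ArchSeq (O : ValuationSubring K) (A₀ : Subalgebra k K) : Prop :=
  ∀ R : ℕ → Subring K, R 0 = locAtCentre A₀.toSubring O →
    (∀ i, IsQuadraticTransformAlong O (R i) (R (i + 1))) →
    ∀ y : K, IsFracOf A₀ y → y ≠ 0 → O.valuation y < 1 →
      ∃ (i : ℕ) (_ : IsLocalRing (R i)) (z : Fin 1 → R i), IsRsopPart z ∧
        ∃ n : ℕ, O.valuation ((z 0 : R i) : K) ^ n < O.valuation y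

/-- **Defect** of the datum: the radicand `t ^ p` has NO `p`-th-power approximation from `Frac A₀`
whose error has value outside the values of `p`-th powers of `Frac A₀`.
[cite: Kuhlmann2010Defect, §2] -/
def Defect (O : ValuationSubring K) (A₀ : Subalgebra k K) (t : K) (p : ℕ) : Prop :=
  ∀ g : K, IsFracOf A₀ g → ∃ w : K, IsFracOf A₀ w ∧ O.valuation (t ^ p - g ^ p) = O.valuation (w ^ p)

end Vocabulary

/-! ## r8 vocabulary (W4.1, the C2 cut): torsor runs along the quadratic sequence

All over existing declarations (`Subring`, `ValuationSubring.valuation`, `Derivation`, `IsRsopPart`); the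
centre of `O` on a member `S = R i` of the quadratic sequence is `{y ∈ S | O.valuation y < 1}` (the members
are dominated by `O`, `stub_switchingSetup`), so no `IsLocalRing` instance has to be threaded. -/

section TorsorRun

variable {K : Type} [Field K]

/-- `x` is an EXCEPTIONAL PARAMETER of the quadratic transform of `S` along `O`: a non-zero element of the
centre of `O` on `S` of maximal `O`-value among such (so that `𝔪_S · S₁ = x · S₁` in the transform `S₁`;
cf. `IsQuadraticTransformAlong.exists_eq_locAtCentre`). [folklore] -/
def IsExcParam (O : ValuationSubring K) (S : Subring K) (x : K) : Prop :=
  x ∈ S ∧ x ≠ 0 ∧ O.valuation x < 1 ∧ ∀ y ∈ S, O.valuation y < 1 → O.valuation y ≤ O.valuation x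

/-- One STRICT-TRANSFORM STEP of a generator of the `α_p`-torsor over `S`: `s = x * s' + g` with `g ∈ S`
(a `p`-th-power cleaner: `s ^ p - g ^ p = x ^ p * s' ^ p`) and `x` an exceptional parameter of `S`.
[cite: arXiv:1802.05010, §2] [folklore] -/
def IsStrictStep (O : ValuationSubring K) (S : Subring K) (s s' : K) : Prop :=
  ∃ x g : K, IsExcParam O S x ∧ g ∈ S ∧ s = x * s' + g

/-- A TORSOR RUN UP TO STAGE `N` of the datum `t` along the sequence `R`: generators `s i` of the
successive strict transforms of `T ^ p = t ^ p`, `s 0 = t`, `(s i) ^ p ∈ R i` for `i ≤ N`, consecutive ones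
linked by strict-transform steps. (Values of `s` beyond `N` are irrelevant.) [folklore] -/
def IsTorsorRunUpTo (O : ValuationSubring K) (R : ℕ → Subring K) (t : K) (p : ℕ) (s : ℕ → K)
    (N : ℕ) : Prop :=
  s 0 = t ∧ (∀ i ≤ N, s i ^ p ∈ R i) ∧ ∀ i < N, IsStrictStep O (R i) (s i) (s (i + 1))

/-- An ETERNAL TORSOR RUN of the datum `t` along `R` (the `p`-adic cleaning run never stalls: multiplicity
`p` after cleaning at every stage). [folklore] -/
def IsTorsorRun (O : ValuationSubring K) (R : ℕ → Subring K) (t : K) (p : ℕ) (s : ℕ → K) : Prop :=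
  s 0 = t ∧ (∀ i, s i ^ p ∈ R i) ∧ ∀ i, IsStrictStep O (R i) (s i) (s (i + 1))

/-- The run CAN STEP at stage `N`: some strict-transform step from `s N` lands with `p`-th power in
`R (N + 1)` — equivalently (for `R N` regular and `R (N + 1)` its quadratic transform along `O`) the
radicand `(s N) ^ p` has order `≥ p` after subtracting a suitable `p`-th power `g ^ p`, `g ∈ R N`: the typed
`MultP` of `IsolatedForcedTermination`. [folklore] -/
def CanStep (O : ValuationSubring K) (R : ℕ → Subring K) (p : ℕ) (s : ℕ → K) (N : ℕ) : Prop :=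
  ∃ s' : K, IsStrictStep O (R N) (s N) s' ∧ s' ^ p ∈ R (N + 1)

/-- The ORDER-ONE FORM at stage `N` (the exit): after cleaning, `(s N) ^ p - g ^ p` is a regular parameter
of `R N` (a one-element part of a regular system of parameters), so that `R N [s N]` is regular.
[cite: arXiv:1505.06445, Prop. 4.4] [folklore] -/
def OrderOneAt (R : ℕ → Subring K) (p : ℕ) (s : ℕ → K) (N : ℕ) : Prop :=
  ∃ g ∈ R N, ∃ (_ : IsLocalRing (R N)) (z : Fin 1 → R N), IsRsopPart z ∧
    ((z 0 : R N) : K) = s N ^ p - g ^ p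

/-- ISOLATED at `S ∋ f`: the Jacobian ideal `⟨δ f | δ : Der_ℤ(S, S)⟩` contains a power of every element of
the centre of `O` on `S` (it is primary to the centre, or all of `S`). For `S` regular, essentially of
finite type over a perfect field, with algebraic residue field, this is the typed `Isol` of
`IsolatedForcedTermination` read in Cohen coordinates (`Der_ℤ S` is free on the partial derivatives).
Invariant under the torsor gauge `f ↦ w ^ p * f + g ^ p` (`w` a unit). [cite: arXiv:1802.05010, §3] [folklore] -/
def IsolAt (O : ValuationSubring K) (S : Subring K) (f : K) : Prop :=
  ∃ (hf : f ∈ S) (N : ℕ), ∀ y : S, O.valuation (y : K) < 1 →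
    y ^ N ∈ Ideal.span (Set.range fun δ : Derivation ℤ S S => δ ⟨f, hf⟩)

end TorsorRun

/-- Torsor LU at zero-dimensional valuation rings over perfect fields of characteristic `p`, for all
data of transcendence degree `< n` — the induction hypothesis handed to the open stub. -/
def TorsorLUZeroDimBelow (p n : ℕ) : Prop :=
  ∀ (k K : Type) [Field k] [CharP k p] [PerfectField k] [Field K] [Algebra k K]
    (O : ValuationSubring K) (A₀ : Subalgebra k K) (h₀ : A₀.toSubring ≤ O.toSubring) (t : K),
    Algebra.trdeg k K < (n : Cardinal) → ZeroDim k O →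
    A₀.FG → t ^ p ∈ A₀ → IsFractionRing (Algebra.adjoin k (insert t (A₀ : Set K))) K →
    IsRegularLocalRing (Localization.AtPrime
      (Ideal.comap (Subring.inclusion h₀) (IsLocalRing.maximalIdeal O))) → Concl O A₀ t

/-! ## Sanity (proved) -/

/-- A field with a finitely generated affine model has natural-number transcendence degree.
[cite: Matsumura1987, Thm. 5.6] -/
theorem exists_trdeg_eq_nat {k K : Type} [Field k] [Field K] [Algebra k K] (A : Subalgebra k K)
    (hA : A.FG) (hfr : IsFractionRing A K) : ∃ n : ℕ, Algebra.trdeg k K = n := by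
  haveI := hfr
  haveI : Algebra.FiniteType k A := A.fg_iff_finiteType.mp hA
  obtain ⟨n, -, hn⟩ := exists_ringKrullDim_eq_and_trdeg_eq k A
  exact ⟨n, by rw [trdeg_eq_trdeg_of_isFractionRing A, hn]⟩

/-! ## The stub STATEMENTS by name -/

/-- Statement of `stub_zeroDimPerfect` (= line `birth`'s `stub_zeroDimReduction`; LANDED p166845). -/
def Sig.stub_zeroDimPerfect : Prop :=
  ∀ p : ℕ, p.Prime → TorsorLUZeroDim p → TorsorLU p

/-- Statement of `stub_switchingDefectless` (r4 form; LANDED p169091 as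
`Theorems.SwitchingDichotomy.switchingDefectlessSeq`): strongly switching + parameter-archimedean +
defectless ⇒ conclusion, any ground field, every dimension. -/
def Sig.stub_switchingDefectless : Prop :=
  ∀ p : ℕ, p.Prime → ∀ (k K : Type) [Field k] [CharP k p] [Field K] [Algebra k K]
    (O : ValuationSubring K) (A₀ : Subalgebra k K) (h₀ : A₀.toSubring ≤ O.toSubring) (t : K),
    A₀.FG → t ^ p ∈ A₀ → IsFractionRing (Algebra.adjoin k (insert t (A₀ : Set K))) K →
    IsRegularLocalRing (Localization.AtPrime
      (Ideal.comap (Subring.inclusion h₀) (IsLocalRing.maximalIdeal O))) →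
    StronglySwitching O A₀ → ArchSeq O A₀ → ¬ Defect O A₀ t p → Concl O A₀ t

/-- Statement of `stub_lu3Perfect` (reshape r7): **local uniformization in dimension `≤ 3` over PERFECT
ground fields of characteristic `p`** — for every perfect field `k` of characteristic `p`, every valuation ring
`O` of a field `K ⊇ k` and every finitely generated `A ⊆ O` with `Frac A = K` and `dim A ≤ 3`, some finitely
generated `A ⊆ A' ⊆ O` is regular at the centre of `O` (the tree's `LocalUniformization3 k`). KNOWN IN PRINT
(Cossart–Piltant 2008/2009 Main Theorem for `k` differentially finite over a perfect field; Cossart–Piltant 2019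
Thm. 1.1 with §4.1 (LU) over every field) and one line from the tree's NAMED FACT `CossartPiltant2019LU3`
(`stub_lu3Perfect_of_cossartPiltant2019LU3` below); unproved in the tree = a formalization debt.
[cite: CossartPiltant2019, Thm. 1.1 with §4.1 (LU)] [cite: CossartPiltant2009, Main Theorem] -/
def Sig.stub_lu3Perfect : Prop :=
  ∀ p : ℕ, p.Prime → ∀ (k : Type) [Field k] [CharP k p] [PerfectField k], LocalUniformization3.{0} k

/-- Statement of `stub_cp2019General` (reshape r15): **Cossart–Piltant 2019, Thm. 1.1 as printed** — every reduced
separated Noetherian quasi-excellent scheme of dimension `≤ 3` has a resolution which is an isomorphism over the regular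
locus (the tree's NAMED FACT `Literature.AlgebraicGeometry.Resolution.CossartPiltant2019General`, unproved there: a
formalization debt, not an open problem). It carries BOTH uses of Cossart–Piltant in this skeleton: local uniformization
in dimension `≤ 3` (`stub_lu3Perfect`, through `CossartPiltant2019General.cossartPiltant2019'` and `CossartPiltant2019.lu3`)
and the composite-rank discharge at `n = 4` (res-L0-w41-idea-1's `concl_of_hasProperCoarsening`).
[cite: CossartPiltant2019, Thm. 1.1] -/
def Sig.stub_cp2019General : Prop :=
  CossartPiltant2019General.{0}

/-- Statement of `stub_steerDefectCore4` (reshape r7): **the dimension-`≥ 4` defect core of `Steer`** — the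
parent crux's registered core F⁹ (`stub_defectCoreFinal` of
`Cruxes/LuAlphaPTorsor/Lines/pfaff_line_log_final_forms.lean`: zero-dimensional NON-Abhyankar valuation at a
closed-point centre of dimension `≥ 3` of the regular base, NOT dense in any finitely generated Abhyankar
subfunction field, not discrete of rank one, no unit `ℤ`-derivative of `t ^ p`, `t ^ p` not a `p`-th power at the
centre) restricted to PERFECT ground fields, intersected with the complement of this line's landed range
(¬ (strongly switching ∧ parameter-archimedean ∧ defectless)), handed the antecedent, torsor LU at all
zero-dimensional valuations in transcendence degree `< n`, and — new in r7 — `trdeg = n ≥ 4` (the r6 core had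
`n ≥ 3`; `n = 3` is `stub_lu3Perfect`). Verbatim an instance of the catalogued barrier
`Literature.Barriers.ResolutionOfSingularities.DimensionFourFrontier`. -/
def Sig.stub_steerDefectCore4 : Prop :=
  IsolatedForcedTermination → ∀ p : ℕ, p.Prime → ∀ n : ℕ, 4 ≤ n → TorsorLUZeroDimBelow p n →
    ∀ (k K : Type) [Field k] [CharP k p] [PerfectField k] [Field K] [Algebra k K]
    (O : ValuationSubring K) (A₀ : Subalgebra k K) (h₀ : A₀.toSubring ≤ O.toSubring) (t : K),
    A₀.FG → ∀ (htp : t ^ p ∈ A₀), IsFractionRing (Algebra.adjoin k (insert t (A₀ : Set K))) K →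
    IsRegularLocalRing (Localization.AtPrime
      (Ideal.comap (Subring.inclusion h₀) (IsLocalRing.maximalIdeal O))) →
    (Ideal.comap (Subring.inclusion h₀) (IsLocalRing.maximalIdeal O)).IsMaximal →
    ZeroDim k O →
    ¬ ringKrullDim (Localization.AtPrime
      (Ideal.comap (Subring.inclusion h₀) (IsLocalRing.maximalIdeal O))) ≤ 2 →
    ¬ IsAbhyankarPlace O (algebraMap k K).fieldRange ⊤ →
    ¬ DenseAbhyankar k O →
    ¬ Discrete O →
    (∀ δ : Derivation ℤ (Localization.AtPrime (Ideal.comap (Subring.inclusion h₀)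
        (IsLocalRing.maximalIdeal O))) (Localization.AtPrime (Ideal.comap (Subring.inclusion h₀)
        (IsLocalRing.maximalIdeal O))),
      ¬ IsUnit (δ (algebraMap A₀.toSubring (Localization.AtPrime (Ideal.comap (Subring.inclusion h₀)
        (IsLocalRing.maximalIdeal O))) ⟨t ^ p, htp⟩))) →
    (∀ c : Localization.AtPrime (Ideal.comap (Subring.inclusion h₀) (IsLocalRing.maximalIdeal O)),
      algebraMap A₀.toSubring (Localization.AtPrime (Ideal.comap (Subring.inclusion h₀)
        (IsLocalRing.maximalIdeal O))) ⟨t ^ p, htp⟩ ≠ c ^ p) →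
    Algebra.trdeg k K = (n : Cardinal) →
    ¬ (StronglySwitching O A₀ ∧ ArchSeq O A₀ ∧ ¬ Defect O A₀ t p) → Concl O A₀ t

/-! ### r8: the cut of the core by the behaviour of the greedy torsor run (W4.1, C2) -/

/-- `stub_core4RunTrichotomy` — **PROVABLE (S/M; bookkeeping + greedy recursion).** For a datum regular at a
centre of dimension `≥ 3` (so the centre is a non-zero ideal and the quadratic sequence of the base along `O`
exists, `stub_switchingSetup`), the GREEDY torsor run (extend by a strict-transform step as long as one lands
with `p`-th power in the next member) is eternal, or reaches a stage in order-one form, or stalls at a stage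
that is neither steppable nor of order one (cleaned order in `[2, p - 1]`). First move: `stub_switchingSetup`
with `a ∈ 𝔪_O ∩ A₀`, `a ≠ 0` from `¬ dim ≤ 2`; then dependent choice. [folklore] -/
def Sig.stub_core4RunTrichotomy : Prop :=
  ∀ (p : ℕ) (k K : Type) [Field k] [Field K] [Algebra k K]
    (O : ValuationSubring K) (A₀ : Subalgebra k K) (h₀ : A₀.toSubring ≤ O.toSubring) (t : K),
    t ^ p ∈ A₀ →
    IsRegularLocalRing (Localization.AtPrime
      (Ideal.comap (Subring.inclusion h₀) (IsLocalRing.maximalIdeal O))) →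
    ¬ ringKrullDim (Localization.AtPrime
      (Ideal.comap (Subring.inclusion h₀) (IsLocalRing.maximalIdeal O))) ≤ 2 →
    ∃ R : ℕ → Subring K, R 0 = locAtCentre A₀.toSubring O ∧
      (∀ i, IsQuadraticTransformAlong O (R i) (R (i + 1))) ∧
      ((∃ s : ℕ → K, IsTorsorRun O R t p s) ∨
        (∃ (s : ℕ → K) (N : ℕ), IsTorsorRunUpTo O R t p s N ∧ OrderOneAt R p s N) ∨
        (∃ (s : ℕ → K) (N : ℕ), IsTorsorRunUpTo O R t p s N ∧ ¬ CanStep O R p s N ∧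
          ¬ OrderOneAt R p s N))

/-- `stub_core4Dictionary` — **PROVABLE (XL; the chain's owned lever: `hT` CONSUMED).** Along a
zero-dimensional valuation ring `O` over a PERFECT field, over a base regular at the (closed-point) centre,
an ETERNAL torsor run is NON-ISOLATED at infinitely many stages. Proof plan (the valuation-run dictionary):
`R i` is regular, essentially of finite type over `k`, with residue field `κ_i ⊆ κ_O` algebraic over `k`, hence
perfect; Cohen coordinates of `R̂ i` FORCED by the run (`u_j ↦ u_j / x - [τ_j]`, `[τ_j]` the coefficient-field
representative of the residue of `u_j / x`) conjugate the strict-transform step to the typed `step` (chart =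
an index `j` with `u_j / x` a unit, translation `τ`), up to the torsor gauge `f ↦ w ^ p * f + h ^ p` (`w` a
unit), under which the typed `Isol` and `MultP` are invariant; `Der_ℤ (R i)` is free on `∂/∂u_j` (perfect
ground field, separable algebraic residue field), so `IsolAt` = typed `Isol`, and `CanStep` with cleaned
series `≠ 0` = typed `MultP`; if the cleaned series vanishes at some stage the Jacobian ideal is `0` from there
on; otherwise `hT` (over `κ = κ_O^alg`, restarted at `i₀`) forbids `Isol` at all stages `≥ i₀`.
[cite: arXiv:1802.05010, §§2–3] [cite: Matsumura1987, Thms. 28.3, 30.6] [folklore] -/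
def Sig.stub_core4Dictionary : Prop :=
  IsolatedForcedTermination → ∀ p : ℕ, p.Prime →
    ∀ (k K : Type) [Field k] [CharP k p] [PerfectField k] [Field K] [Algebra k K]
    (O : ValuationSubring K) (A₀ : Subalgebra k K) (h₀ : A₀.toSubring ≤ O.toSubring) (t : K),
    A₀.FG → t ^ p ∈ A₀ → IsFractionRing (Algebra.adjoin k (insert t (A₀ : Set K))) K →
    IsRegularLocalRing (Localization.AtPrime
      (Ideal.comap (Subring.inclusion h₀) (IsLocalRing.maximalIdeal O))) →
    ZeroDim k O →
    ∀ R : ℕ → Subring K, R 0 = locAtCentre A₀.toSubring O →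
      (∀ i, IsQuadraticTransformAlong O (R i) (R (i + 1))) →
      ∀ s : ℕ → K, IsTorsorRun O R t p s → ∀ i₀ : ℕ, ∃ i, i₀ ≤ i ∧ ¬ IsolAt O (R i) (s i ^ p)

/-- `stub_core4OrderOneExit` — **PROVABLE (S/M; the order-one exit).** If a torsor run reaches a stage `N`
in order-one form — `(s N) ^ p - g ^ p = z` with `z` a regular parameter of `R N` — then `R N [s N]` is
regular at the centre of `O` (`T ^ p - g ^ p - z ∉ 𝔑 ²` for the unique maximal `𝔑 = (𝔪_N, T - g)` over
`𝔪_N`), and re-basing the datum on a finitely generated model of `R N` containing `∏_{i<N} x_i`, the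
accumulated cleaner and `g` (as in `exists_model_of_sequence_member`, `stub_switchingExit`) gives the
regular model: `t = (∏ x_i) * s N + G`. [cite: arXiv:1505.06445, Prop. 4.4] [folklore] -/
def Sig.stub_core4OrderOneExit : Prop :=
  ∀ p : ℕ, p.Prime → ∀ (k K : Type) [Field k] [CharP k p] [Field K] [Algebra k K]
    (O : ValuationSubring K) (A₀ : Subalgebra k K) (h₀ : A₀.toSubring ≤ O.toSubring) (t : K),
    A₀.FG → t ^ p ∈ A₀ → IsFractionRing (Algebra.adjoin k (insert t (A₀ : Set K))) K →
    IsRegularLocalRing (Localization.AtPrime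
      (Ideal.comap (Subring.inclusion h₀) (IsLocalRing.maximalIdeal O))) →
    ∀ R : ℕ → Subring K, R 0 = locAtCentre A₀.toSubring O →
      (∀ i, IsQuadraticTransformAlong O (R i) (R (i + 1))) →
      ∀ (s : ℕ → K) (N : ℕ), IsTorsorRunUpTo O R t p s N → OrderOneAt R p s N → Concl O A₀ t

/-- `stub_core4LowMult` — **FRONTIER-class residual R1 (open problem for `p ≥ 3`; EMPTY, hence provable, for
`p = 2`).** The dimension-`≥ 4` defect core of `Steer` (every hypothesis of `Sig.stub_steerDefectCore4` kept
verbatim, WITHOUT the antecedent) restricted to data whose greedy torsor run STALLS at a stage `N` that is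
neither steppable nor of order one: after cleaning, the radicand `(s N) ^ p` has order `ν` with
`2 ≤ ν ≤ p - 1` in `R N` (`ν ≥ 1` always, the residue field being perfect; `ν = 1` is
`stub_core4OrderOneExit`; `ν ≥ p` is `CanStep`). Here the base-point dynamics of `IsolatedForcedTermination`
is silent (its step degenerates to the total transform) and the hypersurface `T ^ p = (s N) ^ p` has
multiplicity `ν < p`: maximal contact exists for the initial form but the induction lands in resolution of
marked ideals in dimension `n ≥ 4`, characteristic `p` —
`Literature.Barriers.ResolutionOfSingularities.DimensionFourFrontier`. Inhabited for `p ≥ 3` by the K4.1b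
datum `t ^ p = y₁ y₂ + y₃ ^ (p + 1)` (order `2`, stalled at `N = 0`). Why it might fail as a PLAN: no invariant is known to drop for multiplicity-`< p`
purely inseparable hypersurfaces in dimension `≥ 5` (ambient); the statement itself is implied by `Steer`.
[cite: CossartPiltant2019, Rem. 3.2] [cite: arXiv:1412.7697, §7] [cite: CutkoskyMourtada2019, Thm. 7.1] -/
def Sig.stub_core4LowMult : Prop :=
  ∀ p : ℕ, p.Prime → ∀ n : ℕ, 4 ≤ n → TorsorLUZeroDimBelow p n →
    ∀ (k K : Type) [Field k] [CharP k p] [PerfectField k] [Field K] [Algebra k K]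
    (O : ValuationSubring K) (A₀ : Subalgebra k K) (h₀ : A₀.toSubring ≤ O.toSubring) (t : K),
    A₀.FG → ∀ (htp : t ^ p ∈ A₀), IsFractionRing (Algebra.adjoin k (insert t (A₀ : Set K))) K →
    IsRegularLocalRing (Localization.AtPrime
      (Ideal.comap (Subring.inclusion h₀) (IsLocalRing.maximalIdeal O))) →
    (Ideal.comap (Subring.inclusion h₀) (IsLocalRing.maximalIdeal O)).IsMaximal →
    ZeroDim k O →
    ¬ ringKrullDim (Localization.AtPrime
      (Ideal.comap (Subring.inclusion h₀) (IsLocalRing.maximalIdeal O))) ≤ 2 →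
    ¬ IsAbhyankarPlace O (algebraMap k K).fieldRange ⊤ →
    ¬ DenseAbhyankar k O →
    ¬ Discrete O →
    (∀ δ : Derivation ℤ (Localization.AtPrime (Ideal.comap (Subring.inclusion h₀)
        (IsLocalRing.maximalIdeal O))) (Localization.AtPrime (Ideal.comap (Subring.inclusion h₀)
        (IsLocalRing.maximalIdeal O))),
      ¬ IsUnit (δ (algebraMap A₀.toSubring (Localization.AtPrime (Ideal.comap (Subring.inclusion h₀)
        (IsLocalRing.maximalIdeal O))) ⟨t ^ p, htp⟩))) →
    (∀ c : Localization.AtPrime (Ideal.comap (Subring.inclusion h₀) (IsLocalRing.maximalIdeal O)),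
      algebraMap A₀.toSubring (Localization.AtPrime (Ideal.comap (Subring.inclusion h₀)
        (IsLocalRing.maximalIdeal O))) ⟨t ^ p, htp⟩ ≠ c ^ p) →
    Algebra.trdeg k K = (n : Cardinal) →
    ¬ (StronglySwitching O A₀ ∧ ArchSeq O A₀ ∧ ¬ Defect O A₀ t p) →
    ∀ R : ℕ → Subring K, R 0 = locAtCentre A₀.toSubring O →
      (∀ i, IsQuadraticTransformAlong O (R i) (R (i + 1))) →
      ∀ (s : ℕ → K) (N : ℕ), IsTorsorRunUpTo O R t p s N → ¬ CanStep O R p s N →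
        ¬ OrderOneAt R p s N → Concl O A₀ t

/-- Statement of `stub_core4LowMultOdd` (reshape r12; parity split of R1 endorsed by CHAIN v4.4 §B): the stalled
core `stub_core4LowMult` for ODD `p` only — at `p = 2` the stall regime is EMPTY and proved
(`Theorems.SwitchingDichotomy.LowMult.core4LowMult_two`, res-L0-w41-stub-2, p481401). `DimensionFourFrontier` verbatim
(LU of a multiplicity-`ν` hypersurface, `2 ≤ ν < p`, along a zero-dimensional valuation, ambient dimension `≥ 5`).
[cite: CossartPiltant2019, Rem. 3.2] [cite: CutkoskyMourtada2019, Thm. 7.1] -/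
def Sig.stub_core4LowMultOdd : Prop :=
  ∀ p : ℕ, p.Prime → p ≠ 2 → ∀ n : ℕ, 4 ≤ n → TorsorLUZeroDimBelow p n →
    ∀ (k K : Type) [Field k] [CharP k p] [PerfectField k] [Field K] [Algebra k K]
    (O : ValuationSubring K) (A₀ : Subalgebra k K) (h₀ : A₀.toSubring ≤ O.toSubring) (t : K),
    A₀.FG → ∀ (htp : t ^ p ∈ A₀), IsFractionRing (Algebra.adjoin k (insert t (A₀ : Set K))) K →
    IsRegularLocalRing (Localization.AtPrime
      (Ideal.comap (Subring.inclusion h₀) (IsLocalRing.maximalIdeal O))) →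
    (Ideal.comap (Subring.inclusion h₀) (IsLocalRing.maximalIdeal O)).IsMaximal →
    ZeroDim k O →
    ¬ ringKrullDim (Localization.AtPrime
      (Ideal.comap (Subring.inclusion h₀) (IsLocalRing.maximalIdeal O))) ≤ 2 →
    ¬ IsAbhyankarPlace O (algebraMap k K).fieldRange ⊤ →
    ¬ DenseAbhyankar k O →
    ¬ Discrete O →
    (∀ δ : Derivation ℤ (Localization.AtPrime (Ideal.comap (Subring.inclusion h₀)
        (IsLocalRing.maximalIdeal O))) (Localization.AtPrime (Ideal.comap (Subring.inclusion h₀)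
        (IsLocalRing.maximalIdeal O))),
      ¬ IsUnit (δ (algebraMap A₀.toSubring (Localization.AtPrime (Ideal.comap (Subring.inclusion h₀)
        (IsLocalRing.maximalIdeal O))) ⟨t ^ p, htp⟩))) →
    (∀ c : Localization.AtPrime (Ideal.comap (Subring.inclusion h₀) (IsLocalRing.maximalIdeal O)),
      algebraMap A₀.toSubring (Localization.AtPrime (Ideal.comap (Subring.inclusion h₀)
        (IsLocalRing.maximalIdeal O))) ⟨t ^ p, htp⟩ ≠ c ^ p) →
    Algebra.trdeg k K = (n : Cardinal) →
    ¬ (StronglySwitching O A₀ ∧ ArchSeq O A₀ ∧ ¬ Defect O A₀ t p) →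
    ∀ R : ℕ → Subring K, R 0 = locAtCentre A₀.toSubring O →
      (∀ i, IsQuadraticTransformAlong O (R i) (R (i + 1))) →
      ∀ (s : ℕ → K) (N : ℕ), IsTorsorRunUpTo O R t p s N → ¬ CanStep O R p s N →
        ¬ OrderOneAt R p s N → Concl O A₀ t

/-- `stub_core4EternalNonIsolated` — **FRONTIER-class residual R2 (open problem).** The dimension-`≥ 4`
defect core of `Steer` (every hypothesis of `Sig.stub_steerDefectCore4` kept verbatim, WITHOUT the antecedent)
restricted to data with an ETERNAL torsor run that is NON-ISOLATED at infinitely many stages — all that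
`IsolatedForcedTermination` leaves of the eternal (defect) regime once `stub_core4Dictionary` has read the run
as its point dynamics: the Jacobian ideal of the cleaned radicand fails to be `𝔪`-primary again and again, i.e.
the singular locus of the strict transform `T ^ p = (s i) ^ p` keeps a positive-dimensional component through
the centre of `O`. This is the non-isolated half of the defect frontier of local uniformization in dimension
`≥ 4` (`Literature.Barriers.ResolutionOfSingularities.DimensionFourFrontier`); the natural next lever is a
permissible centre INSIDE the non-isolated singular locus (equimultiple curve/surface blow-ups, not point
blow-ups), for which no termination invariant is on record in characteristic `p`. Why it might fail as a PLAN: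
eternal non-isolated runs with defect exist in every dimension `≥ 3` candidate family `t ^ p = y₁ y₂ ^ p + …`
(non-vacuity is chain question K4.1c); the statement itself is implied by `Steer`.
[cite: arXiv:1505.06445, Discussion 4.2] [cite: Kuhlmann2010Defect, §2] [cite: arXiv:1802.05010, §3]
[cite: CutkoskyMourtada2019, Thm. 7.1] -/
def Sig.stub_core4EternalNonIsolated : Prop :=
  ∀ p : ℕ, p.Prime → ∀ n : ℕ, 4 ≤ n → TorsorLUZeroDimBelow p n →
    ∀ (k K : Type) [Field k] [CharP k p] [PerfectField k] [Field K] [Algebra k K]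
    (O : ValuationSubring K) (A₀ : Subalgebra k K) (h₀ : A₀.toSubring ≤ O.toSubring) (t : K),
    A₀.FG → ∀ (htp : t ^ p ∈ A₀), IsFractionRing (Algebra.adjoin k (insert t (A₀ : Set K))) K →
    IsRegularLocalRing (Localization.AtPrime
      (Ideal.comap (Subring.inclusion h₀) (IsLocalRing.maximalIdeal O))) →
    (Ideal.comap (Subring.inclusion h₀) (IsLocalRing.maximalIdeal O)).IsMaximal →
    ZeroDim k O →
    ¬ ringKrullDim (Localization.AtPrime
      (Ideal.comap (Subring.inclusion h₀) (IsLocalRing.maximalIdeal O))) ≤ 2 →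
    ¬ IsAbhyankarPlace O (algebraMap k K).fieldRange ⊤ →
    ¬ DenseAbhyankar k O →
    ¬ Discrete O →
    (∀ δ : Derivation ℤ (Localization.AtPrime (Ideal.comap (Subring.inclusion h₀)
        (IsLocalRing.maximalIdeal O))) (Localization.AtPrime (Ideal.comap (Subring.inclusion h₀)
        (IsLocalRing.maximalIdeal O))),
      ¬ IsUnit (δ (algebraMap A₀.toSubring (Localization.AtPrime (Ideal.comap (Subring.inclusion h₀)
        (IsLocalRing.maximalIdeal O))) ⟨t ^ p, htp⟩))) →
    (∀ c : Localization.AtPrime (Ideal.comap (Subring.inclusion h₀) (IsLocalRing.maximalIdeal O)),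
      algebraMap A₀.toSubring (Localization.AtPrime (Ideal.comap (Subring.inclusion h₀)
        (IsLocalRing.maximalIdeal O))) ⟨t ^ p, htp⟩ ≠ c ^ p) →
    Algebra.trdeg k K = (n : Cardinal) →
    ¬ (StronglySwitching O A₀ ∧ ArchSeq O A₀ ∧ ¬ Defect O A₀ t p) →
    ∀ R : ℕ → Subring K, R 0 = locAtCentre A₀.toSubring O →
      (∀ i, IsQuadraticTransformAlong O (R i) (R (i + 1))) →
      ∀ s : ℕ → K, IsTorsorRun O R t p s → (∀ i₀ : ℕ, ∃ i, i₀ ≤ i ∧ ¬ IsolAt O (R i) (s i ^ p)) →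
        Concl O A₀ t

/-! ## r13 — the PHASE MACHINE of the R1-odd residue (chain planner res-L0-w41-plan-1 g6's typed sub-plan
`L/w41/Sketch-R1-phases.lean` v3, sha16 c42bbe8866b20dc2, §3.3 / §3 / §3.1 / §5 / §6 copied VERBATIM except the
piece `Rebase`, which the holder replaces by the weaker `GenRebase` — see the r13 header) -/

/-! ### r13 §A — the core datum, bundled -/

/-- The hypotheses of `Sig.stub_steerDefectCore4` for one datum `(O, A₀, t)` at `(p, n)`, as ONE proposition
(verbatim conjunction of the r10 binders from `A₀.FG` through `¬ (StronglySwitching ∧ ArchSeq ∧ ¬ Defect)`).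
OURS. [folklore] -/
def CoreDatum (p n : ℕ) (k K : Type) [Field k] [Field K] [Algebra k K]
    (O : ValuationSubring K) (A₀ : Subalgebra k K) (h₀ : A₀.toSubring ≤ O.toSubring) (t : K) : Prop :=
  A₀.FG ∧ ∃ htp : t ^ p ∈ A₀, IsFractionRing (Algebra.adjoin k (insert t (A₀ : Set K))) K ∧
    IsRegularLocalRing (Localization.AtPrime
      (Ideal.comap (Subring.inclusion h₀) (IsLocalRing.maximalIdeal O))) ∧
    (Ideal.comap (Subring.inclusion h₀) (IsLocalRing.maximalIdeal O)).IsMaximal ∧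
    ZeroDim k O ∧
    ¬ ringKrullDim (Localization.AtPrime
      (Ideal.comap (Subring.inclusion h₀) (IsLocalRing.maximalIdeal O))) ≤ 2 ∧
    ¬ IsAbhyankarPlace O (algebraMap k K).fieldRange ⊤ ∧
    ¬ DenseAbhyankar k O ∧
    ¬ Discrete O ∧
    (∀ δ : Derivation ℤ (Localization.AtPrime (Ideal.comap (Subring.inclusion h₀)
        (IsLocalRing.maximalIdeal O))) (Localization.AtPrime (Ideal.comap (Subring.inclusion h₀)
        (IsLocalRing.maximalIdeal O))),
      ¬ IsUnit (δ (algebraMap A₀.toSubring (Localization.AtPrime (Ideal.comap (Subring.inclusion h₀)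
        (IsLocalRing.maximalIdeal O))) ⟨t ^ p, htp⟩))) ∧
    (∀ c : Localization.AtPrime (Ideal.comap (Subring.inclusion h₀) (IsLocalRing.maximalIdeal O)),
      algebraMap A₀.toSubring (Localization.AtPrime (Ideal.comap (Subring.inclusion h₀)
        (IsLocalRing.maximalIdeal O))) ⟨t ^ p, htp⟩ ≠ c ^ p) ∧
    Algebra.trdeg k K = (n : Cardinal) ∧
    ¬ (StronglySwitching O A₀ ∧ ArchSeq O A₀ ∧ ¬ Defect O A₀ t p)

/-! ### r13 §B — phases of the point sequence: re-cleaned generators at every member (sub-plan §3 verbatim) -/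

section Phases

variable {K : Type} [Field K]

/-- `s'` is a GENERATOR of the torsor of `t` over the member `S` of the point sequence: `s' ^ p ∈ S` and
`t ∈ S[s']` (so that `Concl` for `(A', s')` at a finitely generated model `A'` of `S` pushes down to `Concl` for
`(A₀, t)`). ALL generators of simple `S`-orders containing `t` are allowed, affine (`(s - g) / m`) or not
(`s ^ j / m`, `p ∤ j`): e.g. for `s ^ p = x ^ ((p + 1) / 2) · u` (`u` a unit, `p` odd) the generator `s` is stalled
(order `(p + 1) / 2 ∈ [2, p - 1]`) while `s² / x` is a generator with `(s² / x) ^ p = x · u²` of ORDER ONE — an exit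
the affine run cannot see. OURS. [folklore] -/
def GenAt (S : Subring K) (p : ℕ) (t s' : K) : Prop :=
  s' ^ p ∈ S ∧ t ∈ Subring.closure (insert s' (S : Set K))

/-- MAXIMAL generator: every generator `s''` above `s'` (`s' ∈ S[s'']`) is already in `S[s']` — the simple order
`S[s']` is maximal among the `S[s'']`, `s'' ^ p ∈ S` (these are submodules of the integral closure of `S` in `K`,
a finite `S`-module for `S` excellent: maximal ones exist, `MaxGenExists`). Kills FAKE multiplicity: `x · s` is a
generator whenever `s` is, can always take a strict-transform step (`x · s = x · s + 0`), and is never maximal.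
OURS. [folklore] -/
def IsMaxGenAt (S : Subring K) (p : ℕ) (t s' : K) : Prop :=
  GenAt S p t s' ∧ ∀ s'' : K, s'' ^ p ∈ S → s' ∈ Subring.closure (insert s'' (S : Set K)) →
    s'' ∈ Subring.closure (insert s' (S : Set K))

/-- The generator `s'` CAN STEP at `S`: a strict-transform step `s' = x * s'' + g` (`x` an exceptional parameter of
`S` along `O`, `g ∈ S`) lands with `s'' ^ p` in SOME quadratic transform `S₁` of `S` along `O` — for `S` regular,
the cleaned radicand `s' ^ p - g ^ p` has order `≥ p` (`x ^ p S₁ ∩ S = 𝔪_S ^ p`); the typed `MultP` read through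
the dictionary. Stated over SOME `S₁` so that no uniqueness of quadratic transforms is needed. OURS. [folklore] -/
def CanStepAt (O : ValuationSubring K) (S : Subring K) (p : ℕ) (s' : K) : Prop :=
  ∃ (S₁ : Subring K) (s'' : K), IsQuadraticTransformAlong O S S₁ ∧ IsStrictStep O S s' s'' ∧ s'' ^ p ∈ S₁

/-- ORDER-ONE FORM of the generator `s'` over `S`: after cleaning, `s' ^ p - g ^ p` is a regular parameter of `S`
(so `S[s']` is regular local over the centre; shape of r8's `OrderOneAt` at a single member).
[cite: HeinzerEtAl2015, Prop. 4.4] [folklore] -/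
def OrderOneGen (S : Subring K) (p : ℕ) (s' : K) : Prop :=
  ∃ g ∈ S, ∃ (_ : IsLocalRing S) (z : Fin 1 → S), IsRsopPart z ∧ ((z 0 : S) : K) = s' ^ p - g ^ p

/-- EXIT STAGE: some generator of the torsor over `S` is in order-one form. OURS. [folklore] -/
def ExitAt (S : Subring K) (p : ℕ) (t : K) : Prop :=
  ∃ s' : K, GenAt S p t s' ∧ OrderOneGen S p s'

/-- MULTIPLICITY-`p` (RE-ENTRY) STAGE: some MAXIMAL generator can take a strict-transform step. OURS. [folklore] -/
def MultPAt (O : ValuationSubring K) (S : Subring K) (p : ℕ) (t : K) : Prop :=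
  ∃ s' : K, IsMaxGenAt S p t s' ∧ CanStepAt O S p s'

/-- STALL STAGE: a maximal generator exists, no generator exits, no maximal generator steps (every maximal
generator has cleaned order in `[2, p - 1]` when the residue field is perfect). OURS. [folklore] -/
def StallAt (O : ValuationSubring K) (S : Subring K) (p : ℕ) (t : K) : Prop :=
  (∃ s' : K, IsMaxGenAt S p t s') ∧ ¬ ExitAt S p t ∧ ¬ MultPAt O S p t

end Phases

/-! ### r13 §C — the pieces (each a `Prop`; class and owner in the docstring; sub-plan §3.1 / §6 verbatim except
`GenRebase`) -/

/-- **P0 · MaxGenExists** (DISCHARGEABLE, M–L — commutative algebra; REGISTERED STUB r13, `stub_maxGenExists`): over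
every member `R M` of the point sequence of a core datum a MAXIMAL generator exists. Plan: `t` itself is a generator
(`t ^ p ∈ A₀ ⊆ R M`); the orders `R M [s'']` are `R M`-submodules of the integral closure of `R M` in `K`, which is a
FINITE `R M`-module (`R M` is a localisation of a finitely generated `k`-domain `A₁` with `[K : Frac A₁] = p`, tree
`Literature.….NoetherFiniteIntegralClosure_holds` + localisation), so a maximal one above `R M [t]` exists (ACC).
Why it might fail: only as a formalization cost. [cite: Matsumura1987, §32] [folklore] -/
def MaxGenExists : Prop :=
  ∀ p : ℕ, p.Prime → ∀ n : ℕ, 4 ≤ n →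
    ∀ (k K : Type) [Field k] [CharP k p] [PerfectField k] [Field K] [Algebra k K]
    (O : ValuationSubring K) (A₀ : Subalgebra k K) (h₀ : A₀.toSubring ≤ O.toSubring) (t : K),
    CoreDatum p n k K O A₀ h₀ t →
    ∀ R : ℕ → Subring K, R 0 = locAtCentre A₀.toSubring O →
      (∀ i, IsQuadraticTransformAlong O (R i) (R (i + 1))) →
      ∀ M : ℕ, ∃ s' : K, IsMaxGenAt (R M) p t s'

/-- **P1 · GenExit** (DISCHARGED r13 by `Theorems.SwitchingDichotomy.genExit`, lead res-L0-w41-lead-1 g3,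
`Theorems/FrobeniusClosingSteerCore4GenExit.lean`): an exit stage gives `Concl` — re-base at the exiting generator
(`GenRebase`), the LANDED `orderOneExit` (res-L0-w41-stub-3, p479657) at `N = 0` along `i ↦ R (M + i)`, push down.
OURS. [cite: HeinzerEtAl2015, Prop. 4.4] [folklore] -/
def GenExit : Prop :=
  ∀ p : ℕ, p.Prime → ∀ n : ℕ, 4 ≤ n →
    ∀ (k K : Type) [Field k] [CharP k p] [PerfectField k] [Field K] [Algebra k K]
    (O : ValuationSubring K) (A₀ : Subalgebra k K) (h₀ : A₀.toSubring ≤ O.toSubring) (t : K),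
    CoreDatum p n k K O A₀ h₀ t →
    ∀ R : ℕ → Subring K, R 0 = locAtCentre A₀.toSubring O →
      (∀ i, IsQuadraticTransformAlong O (R i) (R (i + 1))) →
      ∀ M : ℕ, ExitAt (R M) p t → Concl O A₀ t

/-- **P2⁰ · GenRebase** (r13, the holder's replacement of the sub-plan's `Rebase`; DISCHARGED by
`Theorems.SwitchingDichotomy.genRebase`, lead res-L0-w41-lead-1 g3, `Theorems/FrobeniusClosingSteerCore4GenExit.lean`):
EVERY generator `s'` over EVERY member `R M` re-bases the datum — a finitely generated `A' ⊇ A₀` inside `O` with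
`locAtCentre A' O = R M`, `s' ^ p ∈ A'`, `t ∈ A'[s']`, `Frac (A'[s']) = K`, regular at the centre, and
`Concl O A' s' → Concl O A₀ t`. No step hypothesis on `s'` and no transfer of the other core binders: the
composition (`concl_of_phasesSSL`) recovers `CoreDatum p n k K O A' h' s'` OR `Concl O A' s'` outright from the
LANDED range cascade of `Steer_of` (`concl_or_coreDatum`), so the sub-plan's `CanStepAt ⇒ hδ / hc` transfer is not
needed anywhere. [cite: NovacoskiSpivakovsky2014, Lemma 2.5] [cite: Abhyankar1956Valuations, Prop. 8] [folklore] -/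
def GenRebase : Prop :=
  ∀ (p : ℕ) (k K : Type) [Field k] [Field K] [Algebra k K]
    (O : ValuationSubring K) (A₀ : Subalgebra k K) (h₀ : A₀.toSubring ≤ O.toSubring) (t : K),
    A₀.FG → t ^ p ∈ A₀ → IsFractionRing (Algebra.adjoin k (insert t (A₀ : Set K))) K →
    IsRegularLocalRing (Localization.AtPrime
      (Ideal.comap (Subring.inclusion h₀) (IsLocalRing.maximalIdeal O))) →
    ∀ R : ℕ → Subring K, R 0 = locAtCentre A₀.toSubring O →
      (∀ i, IsQuadraticTransformAlong O (R i) (R (i + 1))) →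
      ∀ (M : ℕ) (s' : K), s' ^ p ∈ R M → t ∈ Subring.closure (insert s' (R M : Set K)) →
        ∃ (A' : Subalgebra k K) (h' : A'.toSubring ≤ O.toSubring), A₀ ≤ A' ∧
          locAtCentre A'.toSubring O = R M ∧ A'.FG ∧ s' ^ p ∈ A' ∧
          t ∈ Algebra.adjoin k (insert s' (A' : Set K)) ∧
          IsFractionRing (Algebra.adjoin k (insert s' (A' : Set K))) K ∧
          IsRegularLocalRing (Localization.AtPrime
            (Ideal.comap (Subring.inclusion h') (IsLocalRing.maximalIdeal O))) ∧
          (Concl O A' s' → Concl O A₀ t)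

/-! ### r13 §D — the SS cut (sub-plan §5 verbatim): under `StronglySwitching` the point sequence is cofinal among
the models inside `O ∩ Frac A₀` (idea-2 g3's `W_far` — `¬ StronglySwitching`, `ArchSeq`, rank one — inhabits the
hypotheses of the unrestricted alternation phase and is EASY, so the frontier residuals carry `StronglySwitching`
and the complement is the separate piece `NonSwitchingCore`) -/

section SSCut

variable {k K : Type} [Field k] [Field K] [Algebra k K]

/-- Members of a quadratic sequence along `O` increase. [cite: NovacoskiSpivakovsky2014, Def. 2.11] -/
theorem member_monotone (O : ValuationSubring K) (R : ℕ → Subring K)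
    (hRq : ∀ i, IsQuadraticTransformAlong O (R i) (R (i + 1))) : Monotone R :=
  monotone_nat_of_le_succ fun i => by
    obtain ⟨_, h⟩ := hRq i
    exact (Literature.AlgebraicGeometry.Resolution.IsLocalBlowupAlong.isLocalBlowup h).le

/-- **Cofinality under strong switching**: finitely many elements of `O ∩ Frac A₀` lie in a common member of the
point sequence; hence every finitely generated model `A₁ ⊆ O ∩ Frac A₀` does (apply to a generating finset), and
`locAtCentre A₁ O ≤ R M` follows by domination. Pure logic from the definition. OURS.
[cite: HeinzerEtAl2015, Discussion 4.2] -/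
theorem finset_subset_member_of_stronglySwitching (O : ValuationSubring K) (A₀ : Subalgebra k K)
    (hss : StronglySwitching O A₀) (R : ℕ → Subring K) (hR0 : R 0 = locAtCentre A₀.toSubring O)
    (hRq : ∀ i, IsQuadraticTransformAlong O (R i) (R (i + 1))) (F : Finset K)
    (hO : ∀ x ∈ F, x ∈ O) (hfr : ∀ x ∈ F, IsFracOf A₀ x) : ∃ M, (↑F : Set K) ⊆ R M := by
  classical
  have hmono := member_monotone O R hRq
  induction F using Finset.induction_on with
  | empty => exact ⟨0, by simp⟩
  | insert a F ha ih =>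
    obtain ⟨M₁, hM₁⟩ := ih (fun x hx => hO x (Finset.mem_insert_of_mem hx))
      (fun x hx => hfr x (Finset.mem_insert_of_mem hx))
    obtain ⟨i, hi⟩ := hss R hR0 hRq a (hO a (Finset.mem_insert_self a F)) (hfr a (Finset.mem_insert_self a F))
    refine ⟨max M₁ i, ?_⟩
    intro x hx
    rw [Finset.coe_insert, Set.mem_insert_iff] at hx
    rcases hx with rfl | hx
    · exact hmono (le_max_right M₁ i) hi
    · exact hmono (le_max_left M₁ i) (hM₁ hx)

end SSCut

/-! ### r13 §E — log-final exits (sub-plan §6 = res-L0-w41-idea-2 g3's E1/E2 vocabulary `Sketch-idea-2c.lean`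
bc010f70dd4ddc0c, verbatim): a member that is LOG-FINAL for `t` (content of `d(t ^ p)` invertible — E1, exit by the
named fact F-E1 `Literature.RingTheory.Derivation.Posva2023_Lemma_2_37_rank1` p491440 — or an exchanged radicand
toroidal with an exponent prime to `p` — E2, exit by `radicandExchange` p483824 + `stub_switchingExit`) is an exit the
order-one test `ExitAt` does not see; the frontier residuals carry «no member is ever log-final» -/

section LogFinal

variable {k K : Type} [Field k] [Field K] [Algebra k K]

/-- idea-2 verbatim: the Jacobian content ideal of `f ∈ S` is invertible and attained. OURS. [folklore] -/
def ContentInvertible (S : Subring K) (f : S) : Prop :=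
  ∃ h : S, h ≠ 0 ∧ (∀ δ : Derivation ℤ S S, h ∣ δ f) ∧
    ∃ (δ : Derivation ℤ S S) (u : S), IsUnit u ∧ δ f = h * u

/-- idea-2 verbatim: a toroidal presentation of `g` in the local subring `S` with an exponent prime to `p`. OURS.
[folklore] -/
def ToroidalAt (p : ℕ) (S : Subring K) [IsLocalRing S] (g : K) : Prop :=
  ∃ (s : ℕ) (z : Fin s → S), IsRsopPart z ∧ ∃ (m : Fin s → ℕ), (∃ l, ¬ p ∣ m l) ∧
    ∃ u : S, IsUnit u ∧ g = (∏ l, ((z l : S) : K) ^ m l) * (u : K)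

/-- idea-2 verbatim: LOG-FINAL presentation at `S` for `K = (Frac A₀)(t)`: E1 (content of `t ^ p` invertible) or
E2 (an exchanged radicand `t₂ ^ p`, `t₂ ∉ Frac A₀`, toroidal with an exponent prime to `p`). OURS.
[cite: Posva2023, Lemma 9] [folklore] -/
def LogFinalAt (p : ℕ) (S : Subring K) [IsLocalRing S] (A₀ : Subalgebra k K) (t : K) : Prop :=
  (∃ f' : S, (f' : K) = t ^ p ∧ ContentInvertible S f') ∨
    (∃ t₂ : K, ¬ IsFracOf A₀ t₂ ∧ ToroidalAt p S (t₂ ^ p))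

/-- Instance-free wrapper: the member `S` is local and log-final for `t`. OURS. [folklore] -/
def LogExitAt (S : Subring K) (p : ℕ) (A₀ : Subalgebra k K) (t : K) : Prop :=
  ∃ (_ : IsLocalRing S), LogFinalAt p S A₀ t

end LogFinal

/-- **P1ᴸ · LogExit** (DISCHARGEABLE, size M; REGISTERED STUB r13, `stub_logExit`; CHAIN v5.3 row res-L0-w41-stub-9):
a log-final member of the point sequence gives `Concl` — every member `R M` is the centre ring of a finitely
generated model (`GenRebase` with `s' := t`), then idea-2's `LogFinalExitM` (E1 via F-E1 p491440 and their glue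
`SandwichExit_of_FE1`; E2 via `radicandExchange` p483824 + degree-`p` transfer + `stub_switchingExit`). OURS.
[cite: Posva2023, Lemma 9] [folklore] -/
def LogExit : Prop :=
  ∀ p : ℕ, p.Prime → ∀ n : ℕ, 4 ≤ n →
    ∀ (k K : Type) [Field k] [CharP k p] [PerfectField k] [Field K] [Algebra k K]
    (O : ValuationSubring K) (A₀ : Subalgebra k K) (h₀ : A₀.toSubring ≤ O.toSubring) (t : K),
    CoreDatum p n k K O A₀ h₀ t →
    ∀ R : ℕ → Subring K, R 0 = locAtCentre A₀.toSubring O →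
      (∀ i, IsQuadraticTransformAlong O (R i) (R (i + 1))) →
      ∀ M : ℕ, LogExitAt (R M) p A₀ t → Concl O A₀ t

/-- **L · LogFinalExitM** — res-L0-w41-idea-2 g3's MODEL FORM of the two log-final exits, VERBATIM
(`L/res-L0-w41-idea-2/Sketch-idea-2c.lean` v3 sha16 1866cc8b286caf08, `Idea2g3.LogFinalExitM`; REGISTERED STUB r16,
`stub_logFinalExitM` — it is the statement res-L0-w41-stub-9 (E1: commuting `p`-nilpotent frame, `n − 1` iterations of
the named fact F-E1 `Posva2023_Lemma_2_37_rank1` p491440, Frobenius sandwich, finite integral closure), res-L0-w41-stub-6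
(degree-`p` transfer `DegreePTransfer`, p497399, for E2 with `radicandExchange` p483824 + `stub_switchingExit`) and
res-L0-w41-stub-5 (`[F : F^p] = p^n`) are proving, per idea-2's `PLAN-LogFinalExitM.md`): a log-final presentation of
`d(t ^ p)` on a finitely generated regular model `A₁` of `Frac A₀`, `A₀ ≤ A₁ ⊆ O`, gives `Concl`. The member form `LogExit`
is DERIVED from it in this skeleton (`stub_logExit`, via `GenRebase` at `s' := t`). r18: ONE binder added at
res-L0-w41-stub-9's request (04:58:27Z) — `ZeroDim k O` after `A₁.toSubring ≤ O.toSubring` (closed centre: the residue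
field of `locAtCentre A₁ O` is algebraic over the perfect `k`, hence perfect, so Kunz's `p`-basis LIB-03 applies);
composition-neutral (every consumer runs under `CoreDatum`, whose 5th conjunct it is). OURS. [cite: Posva2023, Lemma 9]
[folklore] -/
def LogFinalExitM (p : ℕ) : Prop :=
  ∀ (k K : Type) [Field k] [CharP k p] [PerfectField k] [Field K] [Algebra k K]
    (O : ValuationSubring K) (A₀ A₁ : Subalgebra k K) (h₀ : A₀.toSubring ≤ O.toSubring) (t : K),
    p.Prime → A₀.FG → t ^ p ∈ A₀ → IsFractionRing (Algebra.adjoin k (insert t (A₀ : Set K))) K →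
    IsRegularLocalRing
      (Localization.AtPrime (Ideal.comap (Subring.inclusion h₀) (IsLocalRing.maximalIdeal O))) →
    A₀ ≤ A₁ → A₁.FG → (∀ x ∈ A₁, IsFracOf A₀ x) → A₁.toSubring ≤ O.toSubring → ZeroDim k O →
    ∀ (_ : IsLocalRing (locAtCentre A₁.toSubring O)),
      IsRegularLocalRing (locAtCentre A₁.toSubring O) → LogFinalAt p (locAtCentre A₁.toSubring O) A₀ t →
      Concl O A₀ t

/-- **Φ3ᴸˢ · EternalStallPhaseSSL** (FRONTIER residual; REGISTERED STUB r13, `stub_eternalStallPhaseSSL`; the home of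
res-L0-w41-idea-2's line `foliation-log-final-exit` restricted to stall phases and of `res-L0-w41-strat-1`): a
STRONGLY SWITCHING core datum at odd `p` whose point sequence has a QUIET TAIL — from some stage on every stage is a
stall (a maximal generator exists, no generator is in order-one form, no maximal generator can step: cleaned orders in
`[2, p - 1]` for ever) — and NO member of which is ever log-final, is locally uniformizable. This is
`Literature.Barriers.ResolutionOfSingularities.DimensionFourFrontier` verbatim (LU of a multiplicity-`ν` purely
inseparable hypersurface, `2 ≤ ν < p`, along a zero-dimensional valuation, ambient dimension `≥ 5`) WITH the extra
information «eternal stall, strongly switching (hence, by the core binder, defect or not parameter-archimedean), never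
log-final». No inhabitant is on record (idea-2's `W_far` and tri-2's re-entry datum are NOT strongly switching). Why
it might fail: no invariant is known to improve for multiplicity-`< p` purely inseparable hypersurfaces in ambient
dimension `≥ 5` in characteristic `p`; this may be exactly where the defect lives. [cite: CossartPiltant2019, Rem. 3.2]
[cite: CutkoskyMourtada2019, Thm. 7.1] [cite: HeinzerEtAl2015, Discussion 4.2] OURS. -/
def EternalStallPhaseSSL : Prop :=
  ∀ p : ℕ, p.Prime → p ≠ 2 → ∀ n : ℕ, 4 ≤ n → TorsorLUZeroDimBelow p n →
    ∀ (k K : Type) [Field k] [CharP k p] [PerfectField k] [Field K] [Algebra k K]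
    (O : ValuationSubring K) (A₀ : Subalgebra k K) (h₀ : A₀.toSubring ≤ O.toSubring) (t : K),
    CoreDatum p n k K O A₀ h₀ t → StronglySwitching O A₀ → (n = 4 → ¬ HasProperCoarsening O) →
    ∀ R : ℕ → Subring K, R 0 = locAtCentre A₀.toSubring O →
      (∀ i, IsQuadraticTransformAlong O (R i) (R (i + 1))) →
      (∀ M, ¬ LogExitAt (R M) p A₀ t) →
      (∃ M₀ : ℕ, ∀ M, M₀ ≤ M → StallAt O (R M) p t) → Concl O A₀ t

/-- **Φ4ᴸˢ · EternalAlternationSSL** (FRONTIER residual; REGISTERED STUB r13, `stub_eternalAlternationSSL`; tri-2's open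
object, chain tests K4.1e / K4.1f): a STRONGLY SWITCHING core datum at odd `p` whose point sequence NEVER reaches an
exit stage, has INFINITELY MANY multiplicity-`p` re-entry stages, admits from NO generator at NO stage an eternal affine
torsor run along ANY quadratic sequence from that stage (every re-entry's run dies in a stall), and NO member of which is
ever log-final — is locally uniformizable. No inhabitant is on record (the alternating data known — tri-2's RE-ENTRY
datum `p = 3`, `n = 4`, `f = y₂² + y₃y₄ + y₁³ + y₁²y₂ + y₁⁴`, and idea-2's `W_far` — are absorbing, i.e. not strongly
switching, and belong to `NonSwitchingCore`). No termination invariant spanning re-entries is on record (`χ ≤ ν < p` is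
FALSE across a re-entry, tri-2 T2). Why it might fail: this may be where the defect of rank-one non-Abhyankar valuations
in dimension `≥ 4` lives. [cite: HeinzerEtAl2015, Discussion 4.2] [cite: Kuhlmann2010Defect, §2]
[cite: CutkoskyMourtada2019, Thm. 7.1] OURS. -/
def EternalAlternationSSL : Prop :=
  ∀ p : ℕ, p.Prime → p ≠ 2 → ∀ n : ℕ, 4 ≤ n → TorsorLUZeroDimBelow p n →
    ∀ (k K : Type) [Field k] [CharP k p] [PerfectField k] [Field K] [Algebra k K]
    (O : ValuationSubring K) (A₀ : Subalgebra k K) (h₀ : A₀.toSubring ≤ O.toSubring) (t : K),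
    CoreDatum p n k K O A₀ h₀ t → StronglySwitching O A₀ → (n = 4 → ¬ HasProperCoarsening O) →
    ∀ R : ℕ → Subring K, R 0 = locAtCentre A₀.toSubring O →
      (∀ i, IsQuadraticTransformAlong O (R i) (R (i + 1))) →
      (∀ M, ¬ LogExitAt (R M) p A₀ t) →
      (∀ M, ¬ ExitAt (R M) p t) →
      (∀ M₀ : ℕ, ∃ M, M₀ ≤ M ∧ MultPAt O (R M) p t) →
      (∀ (M : ℕ) (s' : K) (R' : ℕ → Subring K) (u : ℕ → K), GenAt (R M) p t s' →
        R' 0 = R M → (∀ i, IsQuadraticTransformAlong O (R' i) (R' (i + 1))) →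
        ¬ IsTorsorRun O R' s' p u) →
      Concl O A₀ t

/-- **NonSwitchingCore** (FRONTIER as a whole; REGISTERED STUB r13, `stub_nonSwitchingCore`; the `¬ StronglySwitching`
part of the R1-odd core at odd `p` — `W_far`'s home): the point sequence is not cofinal, centres of positive dimension
are needed. PLAN of record (CHAIN v5.2 §A1 (β)/(γ)): on its rank-one (`ArchSeq`) part idea-2's model-free
`FoliationLUR1M` (costume split F-LU + DICT owed, tri-1) + `LogFinalExitM`; its rank `≥ 2` part at `n = 4` is a FACT
DEBT via res-L0-w41-idea-1's landed `concl_of_hasProperCoarsening` (p493179, ⇐ `CossartPiltant2019General`); `n ≥ 5`,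
rank `≥ 2` is not covered by the `Below` antecedent (typed gap, recorded). [cite: HeinzerEtAl2015, Discussion 4.2]
[cite: CossartPiltant2019, Thm. 1.1] OURS. -/
def NonSwitchingCore : Prop :=
  ∀ p : ℕ, p.Prime → p ≠ 2 → ∀ n : ℕ, 4 ≤ n → TorsorLUZeroDimBelow p n →
    ∀ (k K : Type) [Field k] [CharP k p] [PerfectField k] [Field K] [Algebra k K]
    (O : ValuationSubring K) (A₀ : Subalgebra k K) (h₀ : A₀.toSubring ≤ O.toSubring) (t : K),
    CoreDatum p n k K O A₀ h₀ t → (n = 4 → ¬ HasProperCoarsening O) → ¬ StronglySwitching O A₀ → Concl O A₀ t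

/-- **idea-2's sequence form under strong switching** (their `FoliationLUR1S`, compact shape; FRONTIER, unrefuted, NOT
registered: the strong form of the (α) heart — it makes both Φ3ᴸˢ and Φ4ᴸˢ hold vacuously, `…_of_seqLogFinalSS`): a
strongly switching core datum at odd `p` has a LOG-FINAL member. [cite: Posva2023, Lemma 9] OURS. -/
def SeqLogFinalSS : Prop :=
  ∀ p : ℕ, p.Prime → p ≠ 2 → ∀ n : ℕ, 4 ≤ n → TorsorLUZeroDimBelow p n →
    ∀ (k K : Type) [Field k] [CharP k p] [PerfectField k] [Field K] [Algebra k K]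
    (O : ValuationSubring K) (A₀ : Subalgebra k K) (h₀ : A₀.toSubring ≤ O.toSubring) (t : K),
    CoreDatum p n k K O A₀ h₀ t → StronglySwitching O A₀ → (n = 4 → ¬ HasProperCoarsening O) →
    ∀ R : ℕ → Subring K, R 0 = locAtCentre A₀.toSubring O →
      (∀ i, IsQuadraticTransformAlong O (R i) (R (i + 1))) →
      ∃ M, LogExitAt (R M) p A₀ t

/-- idea-2's sequence form makes the quiet-tail residual hold VACUOUSLY. Pure logic. OURS. [folklore] -/
theorem eternalStallPhaseSSL_of_seqLogFinalSS (h : SeqLogFinalSS) : EternalStallPhaseSSL := by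
  intro p hp hp2 n hn hB k K _ _ _ _ _ O A₀ h₀ t core hss hnc R hR0 hRq hnl _
  obtain ⟨M, hM⟩ := h p hp hp2 n hn hB k K O A₀ h₀ t core hss hnc R hR0 hRq
  exact absurd hM (hnl M)

/-- idea-2's sequence form makes the alternation residual hold VACUOUSLY. Pure logic. OURS. [folklore] -/
theorem eternalAlternationSSL_of_seqLogFinalSS (h : SeqLogFinalSS) : EternalAlternationSSL := by
  intro p hp hp2 n hn hB k K _ _ _ _ _ O A₀ h₀ t core hss hnc R hR0 hRq hnl _ _ _
  obtain ⟨M, hM⟩ := h p hp hp2 n hn hB k K O A₀ h₀ t core hss hnc R hR0 hRq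
  exact absurd hM (hnl M)

/-! ## The stubs -/

/-- **LANDED (p166845; shared with line `birth`).** Zero-dimensional reduction keeping the ground field
perfect. [cite: ZariskiSamuel1960, Ch. VI §17; NovacoskiSpivakovsky2014] -/
theorem stub_zeroDimPerfect : Sig.stub_zeroDimPerfect :=
  Summit.ResolutionOfSingularities.ResolutionOfSingularities.Theorems.SwitchingDichotomy.stub_zeroDimPerfect

/-- **LANDED (p169091 = `switchingDefectlessSeq`, composed of p167176, p166601, p166891, p168347).**
Strongly switching ∧ parameter-archimedean ∧ defectless ⇒ torsor LU. [cite: HeinzerEtAl2015, Prop. 4.4]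
[cite: Kato1994, (10.4)] -/
theorem stub_switchingDefectless : Sig.stub_switchingDefectless :=
  fun p hp k K _ _ _ _ O A₀ h₀ t hfg htp hfr hreg hSS hAr hnd =>
    Summit.ResolutionOfSingularities.ResolutionOfSingularities.Theorems.SwitchingDichotomy.switchingDefectlessSeq
      p hp k K O A₀ h₀ t hfg htp hfr hreg hSS hAr hnd

/-- **STUB (reshape r15; the ONE FACT DEBT of the skeleton, not an open problem) — Cossart–Piltant 2019 Thm. 1.1 as
printed.** See `Sig.stub_cp2019General`. [cite: CossartPiltant2019, Thm. 1.1] -/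
theorem stub_cp2019General : Sig.stub_cp2019General := by
  sorry

/-- The old debt is one line from the tree's named fact `CossartPiltant2019LU3` (LU in dimension `≤ 3` over
every field). [cite: CossartPiltant2019, Thm. 1.1 with §4.1 (LU)] -/
theorem stub_lu3Perfect_of_cossartPiltant2019LU3
    (h : Literature.AlgebraicGeometry.Resolution.CossartPiltant2019LU3.{0}) : Sig.stub_lu3Perfect :=
  fun _ _ k _ _ _ => h k

/-- **DERIVED (r15) — local uniformization in dimension `≤ 3` over perfect fields** from the registered debt
`stub_cp2019General` through the tree's `CossartPiltant2019General.cossartPiltant2019'` (Thm. 1.1 ⇒ resolution over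
fields up to dimension 3, with `Matsumura1987_32_polynomial_holds`) and `CossartPiltant2019.lu3` (⇒ (LU) in dimension 3).
[cite: CossartPiltant2019, Thm. 1.1 with §4.1 (LU)] -/
theorem stub_lu3Perfect : Sig.stub_lu3Perfect :=
  stub_lu3Perfect_of_cossartPiltant2019LU3 (CossartPiltant2019General.cossartPiltant2019' stub_cp2019General).lu3

/-- **LANDED (r9: res-L0-w41-stub-2, p473559, `Theorems/FrobeniusClosingSteerCore4RunTrichotomy.lean`) — the quadratic
sequence and the greedy torsor run.** See `Sig.stub_core4RunTrichotomy`. [folklore] -/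
theorem stub_core4RunTrichotomy : Sig.stub_core4RunTrichotomy :=
  fun p k K _ _ _ O A₀ h₀ t htp hreg hdim2 =>
    Summit.ResolutionOfSingularities.ResolutionOfSingularities.Theorems.SwitchingDichotomy.stub_core4RunTrichotomy
      p k K O A₀ h₀ t htp hreg hdim2

/-- **LANDED (r11: `Theorems/FrobeniusClosingSteerCore4Dictionary.lean`, chain W4.1 — lead res-L0-w41-lead-1 with
stub-1/2/3/4) — the valuation-run dictionary: `IsolatedForcedTermination` CONSUMED.** See `Sig.stub_core4Dictionary`. [cite: arXiv:1802.05010, §§2–3] [cite: Matsumura1987, Thms. 28.3, 30.6] -/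
theorem stub_core4Dictionary : Sig.stub_core4Dictionary :=
  fun hT p hp k K _ _ _ _ _ O A₀ h₀ t hfg htp hfr hreg hzd R hR0 hq s hs i₀ =>
    Summit.ResolutionOfSingularities.ResolutionOfSingularities.Theorems.SwitchingDichotomy.stub_core4Dictionary
      hT p hp k K O A₀ h₀ t hfg htp hfr hreg hzd R hR0 hq s hs i₀

/-- **LANDED (r10: res-L0-w41-stub-3, p479657, `Theorems/FrobeniusClosingSteerCore4OrderOneExit.lean`) — the
order-one exit.** See `Sig.stub_core4OrderOneExit`.
[cite: arXiv:1505.06445, Prop. 4.4] [folklore] -/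
theorem stub_core4OrderOneExit : Sig.stub_core4OrderOneExit :=
  fun p hp k K _ _ _ _ O A₀ h₀ t hfg htp hfr hreg R hR0 hq s N hs h1 =>
    Summit.ResolutionOfSingularities.ResolutionOfSingularities.Theorems.SwitchingDichotomy.orderOneExit
      p hp k K O A₀ h₀ t hfg htp hfr hreg R hR0 hq s N hs h1

/-! ### r17 — THE R2 RE-CUT (plan-1 g7's `Sketch-R2-recut.lean` fc3184e97514f93e §4 VERBATIM): R2 ⇔ (n = 4 → rank one)-recut
modulo the fact debt; recut = `R2FourRankOne` (n = 4, rank one: THE LIVE R2 RESIDUAL) ∧ `R2High` (n ≥ 5, parked) -/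

/-- **R2 re-cut** (CHAIN v5.4 §B2): R2 with the ONE extra binder `(n = 4 → ¬ HasProperCoarsening O)` inserted after the
transcendence-degree binder — at `n = 4` the valuation ring has NO proper coarsening (rank one,
`SteerRankThinness.rankOne_of_not_hasProperCoarsening`). DERIVED r17 form of the registered R2 stub (`stub_core4EternalNonIsolated` below is a theorem of the two pieces + the fact). FRONTIER.
[cite: HeinzerEtAl2015, Discussion 4.2] [cite: CossartPiltant2019, Thm. 1.1] -/
def Sig.stub_core4EternalNonIsolatedRecut : Prop :=
  ∀ p : ℕ, p.Prime → ∀ n : ℕ, 4 ≤ n → TorsorLUZeroDimBelow p n →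
    ∀ (k K : Type) [Field k] [CharP k p] [PerfectField k] [Field K] [Algebra k K]
    (O : ValuationSubring K) (A₀ : Subalgebra k K) (h₀ : A₀.toSubring ≤ O.toSubring) (t : K),
    A₀.FG → ∀ (htp : t ^ p ∈ A₀), IsFractionRing (Algebra.adjoin k (insert t (A₀ : Set K))) K →
    IsRegularLocalRing (Localization.AtPrime
      (Ideal.comap (Subring.inclusion h₀) (IsLocalRing.maximalIdeal O))) →
    (Ideal.comap (Subring.inclusion h₀) (IsLocalRing.maximalIdeal O)).IsMaximal →
    ZeroDim k O →
    ¬ ringKrullDim (Localization.AtPrime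
      (Ideal.comap (Subring.inclusion h₀) (IsLocalRing.maximalIdeal O))) ≤ 2 →
    ¬ IsAbhyankarPlace O (algebraMap k K).fieldRange ⊤ →
    ¬ DenseAbhyankar k O →
    ¬ Discrete O →
    (∀ δ : Derivation ℤ (Localization.AtPrime (Ideal.comap (Subring.inclusion h₀)
        (IsLocalRing.maximalIdeal O))) (Localization.AtPrime (Ideal.comap (Subring.inclusion h₀)
        (IsLocalRing.maximalIdeal O))),
      ¬ IsUnit (δ (algebraMap A₀.toSubring (Localization.AtPrime (Ideal.comap (Subring.inclusion h₀)
        (IsLocalRing.maximalIdeal O))) ⟨t ^ p, htp⟩))) →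
    (∀ c : Localization.AtPrime (Ideal.comap (Subring.inclusion h₀) (IsLocalRing.maximalIdeal O)),
      algebraMap A₀.toSubring (Localization.AtPrime (Ideal.comap (Subring.inclusion h₀)
        (IsLocalRing.maximalIdeal O))) ⟨t ^ p, htp⟩ ≠ c ^ p) →
    Algebra.trdeg k K = (n : Cardinal) →
    (n = 4 → ¬ HasProperCoarsening O) →
    ¬ (StronglySwitching O A₀ ∧ ArchSeq O A₀ ∧ ¬ Defect O A₀ t p) →
    ∀ R : ℕ → Subring K, R 0 = locAtCentre A₀.toSubring O →
      (∀ i, IsQuadraticTransformAlong O (R i) (R (i + 1))) →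
      ∀ s : ℕ → K, IsTorsorRun O R t p s → (∀ i₀ : ℕ, ∃ i, i₀ ≤ i ∧ ¬ IsolAt O (R i) (s i ^ p)) →
        Concl O A₀ t

/-- **R2 at n = 4 in RANK ONE** — THE LIVE RESIDUAL of W4.1's R2 (CHAIN v5.4 §B2; cut once more by characteristic in §6): `p` prime, transcendence degree
exactly `4`, no proper coarsening, every other binder of R2 verbatim. No inhabitant of ESSENTIAL DIMENSION 4 is on
record (K4.1c's `W₂′` is rank two; K4.1b / `W_far` / tri-2's / K4.1c's radicands are cylinders). FRONTIER.
[cite: HeinzerEtAl2015, Discussion 4.2] [cite: arXiv:1802.05010, §3] -/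
def R2FourRankOne : Prop :=
  ∀ p : ℕ, p.Prime → TorsorLUZeroDimBelow p 4 →
    ∀ (k K : Type) [Field k] [CharP k p] [PerfectField k] [Field K] [Algebra k K]
    (O : ValuationSubring K) (A₀ : Subalgebra k K) (h₀ : A₀.toSubring ≤ O.toSubring) (t : K),
    A₀.FG → ∀ (htp : t ^ p ∈ A₀), IsFractionRing (Algebra.adjoin k (insert t (A₀ : Set K))) K →
    IsRegularLocalRing (Localization.AtPrime
      (Ideal.comap (Subring.inclusion h₀) (IsLocalRing.maximalIdeal O))) →
    (Ideal.comap (Subring.inclusion h₀) (IsLocalRing.maximalIdeal O)).IsMaximal →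
    ZeroDim k O →
    ¬ ringKrullDim (Localization.AtPrime
      (Ideal.comap (Subring.inclusion h₀) (IsLocalRing.maximalIdeal O))) ≤ 2 →
    ¬ IsAbhyankarPlace O (algebraMap k K).fieldRange ⊤ →
    ¬ DenseAbhyankar k O →
    ¬ Discrete O →
    (∀ δ : Derivation ℤ (Localization.AtPrime (Ideal.comap (Subring.inclusion h₀)
        (IsLocalRing.maximalIdeal O))) (Localization.AtPrime (Ideal.comap (Subring.inclusion h₀)
        (IsLocalRing.maximalIdeal O))),
      ¬ IsUnit (δ (algebraMap A₀.toSubring (Localization.AtPrime (Ideal.comap (Subring.inclusion h₀)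
        (IsLocalRing.maximalIdeal O))) ⟨t ^ p, htp⟩))) →
    (∀ c : Localization.AtPrime (Ideal.comap (Subring.inclusion h₀) (IsLocalRing.maximalIdeal O)),
      algebraMap A₀.toSubring (Localization.AtPrime (Ideal.comap (Subring.inclusion h₀)
        (IsLocalRing.maximalIdeal O))) ⟨t ^ p, htp⟩ ≠ c ^ p) →
    Algebra.trdeg k K = ((4 : ℕ) : Cardinal) →
    ¬ HasProperCoarsening O →
    ¬ (StronglySwitching O A₀ ∧ ArchSeq O A₀ ∧ ¬ Defect O A₀ t p) →
    ∀ R : ℕ → Subring K, R 0 = locAtCentre A₀.toSubring O →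
      (∀ i, IsQuadraticTransformAlong O (R i) (R (i + 1))) →
      ∀ s : ℕ → K, IsTorsorRun O R t p s → (∀ i₀ : ℕ, ∃ i, i₀ ≤ i ∧ ¬ IsolAt O (R i) (s i ^ p)) →
        Concl O A₀ t

/-- **R2 in transcendence degree `≥ 5`** — R2 verbatim with `4 < n`; UNCOVERED by any landed range and PARKED (CHAIN
v5.4 §B2: at `n ≥ 5` the composite-rank discharge would need local uniformization of ALL quasi-excellent local rings
of dimension `≤ n - 1`, not in print). FRONTIER. [cite: HeinzerEtAl2015, Discussion 4.2] -/
def R2High : Prop :=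
  ∀ p : ℕ, p.Prime → ∀ n : ℕ, 4 < n → TorsorLUZeroDimBelow p n →
    ∀ (k K : Type) [Field k] [CharP k p] [PerfectField k] [Field K] [Algebra k K]
    (O : ValuationSubring K) (A₀ : Subalgebra k K) (h₀ : A₀.toSubring ≤ O.toSubring) (t : K),
    A₀.FG → ∀ (htp : t ^ p ∈ A₀), IsFractionRing (Algebra.adjoin k (insert t (A₀ : Set K))) K →
    IsRegularLocalRing (Localization.AtPrime
      (Ideal.comap (Subring.inclusion h₀) (IsLocalRing.maximalIdeal O))) →
    (Ideal.comap (Subring.inclusion h₀) (IsLocalRing.maximalIdeal O)).IsMaximal →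
    ZeroDim k O →
    ¬ ringKrullDim (Localization.AtPrime
      (Ideal.comap (Subring.inclusion h₀) (IsLocalRing.maximalIdeal O))) ≤ 2 →
    ¬ IsAbhyankarPlace O (algebraMap k K).fieldRange ⊤ →
    ¬ DenseAbhyankar k O →
    ¬ Discrete O →
    (∀ δ : Derivation ℤ (Localization.AtPrime (Ideal.comap (Subring.inclusion h₀)
        (IsLocalRing.maximalIdeal O))) (Localization.AtPrime (Ideal.comap (Subring.inclusion h₀)
        (IsLocalRing.maximalIdeal O))),
      ¬ IsUnit (δ (algebraMap A₀.toSubring (Localization.AtPrime (Ideal.comap (Subring.inclusion h₀)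
        (IsLocalRing.maximalIdeal O))) ⟨t ^ p, htp⟩))) →
    (∀ c : Localization.AtPrime (Ideal.comap (Subring.inclusion h₀) (IsLocalRing.maximalIdeal O)),
      algebraMap A₀.toSubring (Localization.AtPrime (Ideal.comap (Subring.inclusion h₀)
        (IsLocalRing.maximalIdeal O))) ⟨t ^ p, htp⟩ ≠ c ^ p) →
    Algebra.trdeg k K = (n : Cardinal) →
    ¬ (StronglySwitching O A₀ ∧ ArchSeq O A₀ ∧ ¬ Defect O A₀ t p) →
    ∀ R : ℕ → Subring K, R 0 = locAtCentre A₀.toSubring O →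
      (∀ i, IsQuadraticTransformAlong O (R i) (R (i + 1))) →
      ∀ s : ℕ → K, IsTorsorRun O R t p s → (∀ i₀ : ℕ, ∃ i, i₀ ≤ i ∧ ¬ IsolAt O (R i) (s i ^ p)) →
        Concl O A₀ t

/-! ### r19 — CHARACTERISTIC SPLIT of the live R2 residual (plan-1 g7's `Sketch-R2-recut.lean` v2 42fceeb46e145bfe §6
VERBATIM, CHAIN v5.4a; WORD 04:57:11Z): `R2FourRankOne` = `R2FourRankOneTwo` (p = 2: the σ-steered composition's target —
X `SteeredExit` p497302 + E `SteeredRunExists` + the empty steered stall at p = 2 + the σ-residuals, to be DERIVED at the next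
boundary) ∧ `R2FourRankOneOdd` (odd p: unified-machine design target); the odd piece and `R2High` are PARKED together as ONE
registered name `stub_R2OddHigh`. -/

section CharSplit

/-- **R2 at n = 4, rank one, p = 2** — the target a σ-steered composition can conclude BY NAME under r15 without a
cycle (stall oracle = the landed `LowMult.core4LowMult_two`; steered stalls are expected to be EMPTY at `p = 2`).
Stated with a bound `p` and the binder `p = 2` so that every other binder is R2-verbatim. FRONTIER (no admissible
inhabitant of its hypotheses known — PREREG K4.1f). [cite: HeinzerEtAl2015, Discussion 4.2] -/
def R2FourRankOneTwo : Prop :=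
  ∀ p : ℕ, p = 2 → TorsorLUZeroDimBelow p 4 →
    ∀ (k K : Type) [Field k] [CharP k p] [PerfectField k] [Field K] [Algebra k K]
    (O : ValuationSubring K) (A₀ : Subalgebra k K) (h₀ : A₀.toSubring ≤ O.toSubring) (t : K),
    A₀.FG → ∀ (htp : t ^ p ∈ A₀), IsFractionRing (Algebra.adjoin k (insert t (A₀ : Set K))) K →
    IsRegularLocalRing (Localization.AtPrime
      (Ideal.comap (Subring.inclusion h₀) (IsLocalRing.maximalIdeal O))) →
    (Ideal.comap (Subring.inclusion h₀) (IsLocalRing.maximalIdeal O)).IsMaximal →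
    ZeroDim k O →
    ¬ ringKrullDim (Localization.AtPrime
      (Ideal.comap (Subring.inclusion h₀) (IsLocalRing.maximalIdeal O))) ≤ 2 →
    ¬ IsAbhyankarPlace O (algebraMap k K).fieldRange ⊤ →
    ¬ DenseAbhyankar k O →
    ¬ Discrete O →
    (∀ δ : Derivation ℤ (Localization.AtPrime (Ideal.comap (Subring.inclusion h₀)
        (IsLocalRing.maximalIdeal O))) (Localization.AtPrime (Ideal.comap (Subring.inclusion h₀)
        (IsLocalRing.maximalIdeal O))),
      ¬ IsUnit (δ (algebraMap A₀.toSubring (Localization.AtPrime (Ideal.comap (Subring.inclusion h₀)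
        (IsLocalRing.maximalIdeal O))) ⟨t ^ p, htp⟩))) →
    (∀ c : Localization.AtPrime (Ideal.comap (Subring.inclusion h₀) (IsLocalRing.maximalIdeal O)),
      algebraMap A₀.toSubring (Localization.AtPrime (Ideal.comap (Subring.inclusion h₀)
        (IsLocalRing.maximalIdeal O))) ⟨t ^ p, htp⟩ ≠ c ^ p) →
    Algebra.trdeg k K = ((4 : ℕ) : Cardinal) →
    ¬ HasProperCoarsening O →
    ¬ (StronglySwitching O A₀ ∧ ArchSeq O A₀ ∧ ¬ Defect O A₀ t p) →
    ∀ R : ℕ → Subring K, R 0 = locAtCentre A₀.toSubring O →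
      (∀ i, IsQuadraticTransformAlong O (R i) (R (i + 1))) →
      ∀ s : ℕ → K, IsTorsorRun O R t p s → (∀ i₀ : ℕ, ∃ i, i₀ ≤ i ∧ ¬ IsolAt O (R i) (s i ^ p)) →
        Concl O A₀ t

/-- **R2 at n = 4, rank one, p odd** — design target of the UNIFIED MACHINE (oracle-free stall re-base + one frontier
alternation residual; CHAIN v5.4a). FRONTIER. [cite: HeinzerEtAl2015, Discussion 4.2] [cite: arXiv:1802.05010, §3] -/
def R2FourRankOneOdd : Prop :=
  ∀ p : ℕ, p.Prime → p ≠ 2 → TorsorLUZeroDimBelow p 4 →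
    ∀ (k K : Type) [Field k] [CharP k p] [PerfectField k] [Field K] [Algebra k K]
    (O : ValuationSubring K) (A₀ : Subalgebra k K) (h₀ : A₀.toSubring ≤ O.toSubring) (t : K),
    A₀.FG → ∀ (htp : t ^ p ∈ A₀), IsFractionRing (Algebra.adjoin k (insert t (A₀ : Set K))) K →
    IsRegularLocalRing (Localization.AtPrime
      (Ideal.comap (Subring.inclusion h₀) (IsLocalRing.maximalIdeal O))) →
    (Ideal.comap (Subring.inclusion h₀) (IsLocalRing.maximalIdeal O)).IsMaximal →
    ZeroDim k O →
    ¬ ringKrullDim (Localization.AtPrime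
      (Ideal.comap (Subring.inclusion h₀) (IsLocalRing.maximalIdeal O))) ≤ 2 →
    ¬ IsAbhyankarPlace O (algebraMap k K).fieldRange ⊤ →
    ¬ DenseAbhyankar k O →
    ¬ Discrete O →
    (∀ δ : Derivation ℤ (Localization.AtPrime (Ideal.comap (Subring.inclusion h₀)
        (IsLocalRing.maximalIdeal O))) (Localization.AtPrime (Ideal.comap (Subring.inclusion h₀)
        (IsLocalRing.maximalIdeal O))),
      ¬ IsUnit (δ (algebraMap A₀.toSubring (Localization.AtPrime (Ideal.comap (Subring.inclusion h₀)
        (IsLocalRing.maximalIdeal O))) ⟨t ^ p, htp⟩))) →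
    (∀ c : Localization.AtPrime (Ideal.comap (Subring.inclusion h₀) (IsLocalRing.maximalIdeal O)),
      algebraMap A₀.toSubring (Localization.AtPrime (Ideal.comap (Subring.inclusion h₀)
        (IsLocalRing.maximalIdeal O))) ⟨t ^ p, htp⟩ ≠ c ^ p) →
    Algebra.trdeg k K = ((4 : ℕ) : Cardinal) →
    ¬ HasProperCoarsening O →
    ¬ (StronglySwitching O A₀ ∧ ArchSeq O A₀ ∧ ¬ Defect O A₀ t p) →
    ∀ R : ℕ → Subring K, R 0 = locAtCentre A₀.toSubring O →
      (∀ i, IsQuadraticTransformAlong O (R i) (R (i + 1))) →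
      ∀ s : ℕ → K, IsTorsorRun O R t p s → (∀ i₀ : ℕ, ∃ i, i₀ ≤ i ∧ ¬ IsolAt O (R i) (s i ^ p)) →
        Concl O A₀ t

/-- The characteristic split re-assembles the live residual. Pure logic. [folklore] -/
theorem fourRankOne_of_two_odd (h2 : R2FourRankOneTwo) (hodd : R2FourRankOneOdd) : R2FourRankOne := by
  intro p hp hB
  by_cases hp2 : p = 2
  · exact h2 p hp2 hB
  · exact hodd p hp hp2 hB

/-- … and loses nothing. Pure logic. [folklore] -/
theorem two_odd_of_fourRankOne (h : R2FourRankOne) : R2FourRankOneTwo ∧ R2FourRankOneOdd :=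
  ⟨fun p hp2 hB => h p (hp2 ▸ Nat.prime_two) hB, fun p hp _ hB => h p hp hB⟩

end CharSplit

/-- **R2OddHigh** (r19; ONE parked registered name, plan-1 WORD 04:57:11Z (2)): the odd-characteristic rank-one residual at
`n = 4` together with the transcendence-degree-`≥ 5` residual. FRONTIER, PARKED. -/
def R2OddHigh : Prop :=
  R2FourRankOneOdd ∧ R2High

/-- **STUB (r19; FRONTIER — THE LIVE R2 RESIDUAL OF W4.1 AT p = 2) — `R2FourRankOneTwo`: R2 at `p = 2`, `n = 4`, along a
valuation ring WITHOUT proper coarsening (rank one).** No admissible inhabitant of its hypotheses is known (PREREG K4.1f;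
K4.1d hunts σ_top eternal runs at p = 2, n = 4); the σ-steered composition (Sketch-R2-steered) is ACYCLIC here (its stall
oracle is the landed `LowMult.core4LowMult_two`, and steered stalls `2 ≤ ν < p` are EMPTY at `p = 2`), so this stub is to be
DERIVED from X (p497302), E (stub-8) and the σ-residual names `NoEternalSteeredTailTwo` / `RadicandChainFiniteTwo` at the
next boundary. `Literature.Barriers.ResolutionOfSingularities.DimensionFourFrontier`. [cite: HeinzerEtAl2015, Discussion 4.2]
[cite: arXiv:1802.05010, §3] -/
theorem stub_R2FourRankOneTwo : R2FourRankOneTwo := by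
  sorry

/-- **STUB (r19; FRONTIER, PARKED, ONE NAME) — `R2OddHigh` = `R2FourRankOneOdd ∧ R2High`.** Odd `p` at `n = 4` in rank one is
the unified-machine design target (oracle-free steered stall re-base + one alternation residual, CHAIN v5.4a); `n ≥ 5` is
uncovered by any landed range. `Literature.Barriers.ResolutionOfSingularities.DimensionFourFrontier`.
[cite: HeinzerEtAl2015, Discussion 4.2] [cite: CutkoskyMourtada2019, Thm. 7.1] -/
theorem stub_R2OddHigh : R2OddHigh := by
  sorry

/-- **DERIVED (r19)**: the r17 live residual from its characteristic pieces. [folklore] -/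
theorem stub_R2FourRankOne : R2FourRankOne :=
  fourRankOne_of_two_odd stub_R2FourRankOneTwo stub_R2OddHigh.1

/-- **DERIVED (r19)**: the parked `n ≥ 5` residual is the second half of `stub_R2OddHigh`. [folklore] -/
theorem stub_R2High : R2High :=
  stub_R2OddHigh.2

section Compositions

open Summit.ResolutionOfSingularities.ResolutionOfSingularities.Theorems.SteerRankThinness
  (concl_of_hasProperCoarsening)

/-- **(γ₄) composition, kernel-checked**: the single fact debt and the re-cut give the registered R2 VERBATIM. At
`n = 4` with a proper coarsening, idea-1's landed `concl_of_hasProperCoarsening` (p493665) concludes from the four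
cheap binders; otherwise the re-cut applies. Pure logic over the tree. [folklore] -/
theorem core4EternalNonIsolated_of_recut (hCP : Sig.stub_cp2019General)
    (h : Sig.stub_core4EternalNonIsolatedRecut) : Sig.stub_core4EternalNonIsolated := by
  intro p hp n hn hB k K _ _ _ _ _ O A₀ h₀ t hfg htp hfr hreg hmax hZ hdim hAbh hDA hD hδ hc htr hcore R hR0 hRq
    s hs hni
  by_cases hγ : n = 4 ∧ HasProperCoarsening O
  · obtain ⟨rfl, hO⟩ := hγ
    have h4 : Algebra.trdeg k K ≤ 4 := by rw [htr]; norm_num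
    exact concl_of_hasProperCoarsening hCP p hp.ne_zero h4 O hO A₀ h₀ t hfg htp hfr
  · exact h p hp n hn hB k K O A₀ h₀ t hfg htp hfr hreg hmax hZ hdim hAbh hDA hD hδ hc htr
      (fun h4 hO => hγ ⟨h4, hO⟩) hcore R hR0 hRq s hs hni

/-- Converse (honesty: the re-cut is the registered R2 minus a case, never stronger). Pure logic. [folklore] -/
theorem recut_of_core4EternalNonIsolated (h : Sig.stub_core4EternalNonIsolated) :
    Sig.stub_core4EternalNonIsolatedRecut := by
  intro p hp n hn hB k K _ _ _ _ _ O A₀ h₀ t hfg htp hfr hreg hmax hZ hdim hAbh hDA hD hδ hc htr _ hcore R hR0 hRq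
    s hs hni
  exact h p hp n hn hB k K O A₀ h₀ t hfg htp hfr hreg hmax hZ hdim hAbh hDA hD hδ hc htr hcore R hR0 hRq s hs hni

/-- **Dimension split of the re-cut, kernel-checked**: `R2FourRankOne` and `R2High` give the re-cut. Pure logic.
[folklore] -/
theorem recut_of_split (h4 : R2FourRankOne) (h5 : R2High) : Sig.stub_core4EternalNonIsolatedRecut := by
  intro p hp n hn hB k K _ _ _ _ _ O A₀ h₀ t hfg htp hfr hreg hmax hZ hdim hAbh hDA hD hδ hc htr hγ hcore R hR0 hRq
    s hs hni
  rcases Nat.eq_or_lt_of_le hn with h | h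
  · subst h
    exact h4 p hp hB k K O A₀ h₀ t hfg htp hfr hreg hmax hZ hdim hAbh hDA hD hδ hc htr (hγ rfl) hcore R hR0 hRq
      s hs hni
  · exact h5 p hp n h hB k K O A₀ h₀ t hfg htp hfr hreg hmax hZ hdim hAbh hDA hD hδ hc htr hcore R hR0 hRq s hs hni

/-- The two pieces are each implied by the registered R2 (so the split loses nothing and adds nothing false).
Pure logic. [folklore] -/
theorem split_of_core4EternalNonIsolated (h : Sig.stub_core4EternalNonIsolated) : R2FourRankOne ∧ R2High := by
  refine ⟨?_, ?_⟩
  · intro p hp hB k K _ _ _ _ _ O A₀ h₀ t hfg htp hfr hreg hmax hZ hdim hAbh hDA hD hδ hc htr _ hcore R hR0 hRq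
      s hs hni
    exact h p hp 4 le_rfl hB k K O A₀ h₀ t hfg htp hfr hreg hmax hZ hdim hAbh hDA hD hδ hc htr hcore R hR0 hRq
      s hs hni
  · intro p hp n hn hB k K _ _ _ _ _ O A₀ h₀ t hfg htp hfr hreg hmax hZ hdim hAbh hDA hD hδ hc htr hcore R hR0 hRq
      s hs hni
    exact h p hp n hn.le hB k K O A₀ h₀ t hfg htp hfr hreg hmax hZ hdim hAbh hDA hD hδ hc htr hcore R hR0 hRq
      s hs hni

/-- **r14 proposal in one line**: ONE fact debt + the two dimension pieces give the registered R2. [folklore] -/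
theorem core4EternalNonIsolated_of_pieces (hCP : Sig.stub_cp2019General) (h4 : R2FourRankOne) (h5 : R2High) :
    Sig.stub_core4EternalNonIsolated :=
  core4EternalNonIsolated_of_recut hCP (recut_of_split h4 h5)

end Compositions

/-- **Characteristic-split assembly (recut v2 §6)**: ONE fact debt + `p = 2` piece + odd piece + `n ≥ 5`
piece give the registered R2. [folklore] -/
theorem core4EternalNonIsolated_of_charPieces (hCP : Sig.stub_cp2019General) (h2 : R2FourRankOneTwo)
    (hodd : R2FourRankOneOdd) (h5 : R2High) : Sig.stub_core4EternalNonIsolated :=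
  core4EternalNonIsolated_of_pieces hCP (fourRankOne_of_two_odd h2 hodd) h5



/-- **R2 DERIVED (r17)**: the registered r8/r12 statement `Sig.stub_core4EternalNonIsolated` VERBATIM from the fact debt
`stub_cp2019General` (composite rank at `n = 4`, idea-1's p493665) and the two registered pieces `stub_R2FourRankOne`,
`stub_R2High` (plan-1 g7's re-cut, kernel-checked `core4EternalNonIsolated_of_pieces`). [folklore] -/
theorem stub_core4EternalNonIsolated : Sig.stub_core4EternalNonIsolated :=
  core4EternalNonIsolated_of_pieces stub_cp2019General stub_R2FourRankOne stub_R2High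

/-! ### r13/r14 — the pieces of the phase machine: P1 `GenExit` and P2⁰ `GenRebase` DISCHARGED by name (lead-1 g3,
`Theorems/FrobeniusClosingSteerCore4GenExit.lean`), P0 `MaxGenExists` DISCHARGED (stub-10, p496225); P1ᴸ, Φ3ᴸˢ, Φ4ᴸˢ,
`NonSwitchingCore` REGISTERED -/

/-- **DISCHARGED (r14: res-D-pv-004 AS res-L0-w41-stub-10, p496225,
`Theorems/FrobeniusClosingSteerMaxGenExists.lean`, `MaxGenExists.exists_isMaxGenAt_of_sequence`) — P0 `MaxGenExists`:**
maximal simple orders containing `t` exist over every member (finite integral closure of `R M` in `K` + ACC).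
[cite: Liu2002, Prop. 4.1.27, p. 122] [cite: Matsumura1987, §32] -/
theorem stub_maxGenExists : MaxGenExists := by
  intro p hp n _ k K _ _ _ _ _ O A₀ h₀ t core R hR0 hRq M
  obtain ⟨hfg, htp, hfr, -⟩ := core
  exact Summit.ResolutionOfSingularities.ResolutionOfSingularities.Theorems.SwitchingDichotomy.MaxGenExists.exists_isMaxGenAt_of_sequence
    k K O A₀ h₀ hfg hp.ne_zero htp hfr R hR0 hRq M

/-- **DISCHARGED (r13: lead res-L0-w41-lead-1 g3, `Theorems.SwitchingDichotomy.genExit`,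
`Theorems/FrobeniusClosingSteerCore4GenExit.lean`) — P1 `GenExit`, the generator exit.**
[cite: HeinzerEtAl2015, Prop. 4.4] [folklore] -/
theorem genExit_holds : GenExit := by
  intro p hp n _ k K _ _ _ _ _ O A₀ h₀ t core R hR0 hRq M hM
  obtain ⟨hfg, htp, hfr, hreg, -⟩ := core
  obtain ⟨s', ⟨hsp, ht⟩, hone⟩ := hM
  exact Summit.ResolutionOfSingularities.ResolutionOfSingularities.Theorems.SwitchingDichotomy.genExit p hp k K O
    A₀ h₀ t hfg htp hfr hreg R hR0 hRq M s' hsp ht hone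

/-- **DISCHARGED (r13: lead res-L0-w41-lead-1 g3, `Theorems.SwitchingDichotomy.genRebase`,
`Theorems/FrobeniusClosingSteerCore4GenExit.lean`) — P2⁰ `GenRebase`, every generator over every member re-bases
the datum.** [cite: NovacoskiSpivakovsky2014, Lemma 2.5] [folklore] -/
theorem genRebase_holds : GenRebase :=
  fun p k K _ _ _ O A₀ h₀ t hfg htp hfr hreg R hR0 hRq M s' hsp ht =>
    Summit.ResolutionOfSingularities.ResolutionOfSingularities.Theorems.SwitchingDichotomy.genRebase p k K O A₀ h₀
      t hfg htp hfr hreg R hR0 hRq M s' hsp ht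

/-- **STUB (r16; DISCHARGEABLE, M–L; staffed: res-L0-w41-stub-9 / -6 / -5) — L `LogFinalExitM`, idea-2's model form of the
log-final exits, verbatim.** See `LogFinalExitM`. [cite: Posva2023, Lemma 9] -/
theorem stub_logFinalExitM : ∀ p : ℕ, LogFinalExitM p := by
  sorry

/-- **P1ᴸ `LogExit` DERIVED (r16)** from the registered `stub_logFinalExitM`: the log-final member `R M` is the centre
ring of the finitely generated model `A'` of `GenRebase` at the generator `s' := t` (LANDED `genRebase`, p495493), whose
elements are fractions of `A₀` (`sequence_le_subfield`), and which is regular at the centre; then idea-2's model form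
concludes. Pure bookkeeping. OURS. [folklore] -/
theorem stub_logExit : LogExit := by
  intro p hp n _ k K _ _ _ _ _ O A₀ h₀ t core R hR0 hRq M hM
  classical
  obtain ⟨hfg, htp, hfr, hreg, -, hzd, -⟩ := core
  -- `t` is a generator over the member `R M`
  have htRM : t ^ p ∈ R M :=
    member_monotone O R hRq (Nat.zero_le M)
      (by rw [hR0]; exact Literature.AlgebraicGeometry.Resolution.le_locAtCentre A₀.toSubring O htp)
  have ht : t ∈ Subring.closure (insert t (R M : Set K)) := Subring.subset_closure (Set.mem_insert t _)
  obtain ⟨A', h', hA₀A', hRM', hfg', -, -, -, hreg', -⟩ :=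
    genRebase_holds p k K O A₀ h₀ t hfg htp hfr hreg R hR0 hRq M t htRM ht
  -- the model lies in `R M ⊆ Frac A₀`
  have hF0 : R 0 ≤ (Subfield.closure ((A₀.toSubring : Subring K) : Set K)).toSubring := by
    rw [hR0]
    exact Summit.ResolutionOfSingularities.ResolutionOfSingularities.Theorems.SwitchingDichotomy.locAtCentre_le_subfield
      O fun x hx => Subfield.subset_closure hx
  have hRF := Summit.ResolutionOfSingularities.ResolutionOfSingularities.Theorems.SwitchingDichotomy.sequence_le_subfield
    hF0 hRq M
  have hA'R : A'.toSubring ≤ R M := by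
    rw [← hRM']
    exact Literature.AlgebraicGeometry.Resolution.le_locAtCentre A'.toSubring O
  have hfrac : ∀ x ∈ A', IsFracOf A₀ x := fun x hx => by
    obtain ⟨y, hy, z, hz, hz0, hxyz⟩ :=
      Summit.ResolutionOfSingularities.ResolutionOfSingularities.Theorems.SwitchingDichotomy.exists_div_eq_of_mem_subfieldClosure
        (hRF (hA'R hx))
    exact ⟨y, hy, z, hz, hz0, hxyz⟩
  -- the member is the centre ring of `A'`: transport the log-final presentation and regularity
  rw [← hRM'] at hM
  obtain ⟨hloc, hLF⟩ := hM
  exact stub_logFinalExitM p k K O A₀ A' h₀ t hp hfg htp hfr hreg hA₀A' hfg' hfrac h' hzd hloc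
    ((Literature.AlgebraicGeometry.Resolution.isRegularLocalRing_locAtCentre_iff h').mpr hreg') hLF

/-- **STUB (r13; FRONTIER) — Φ3ᴸˢ `EternalStallPhaseSSL`, the quiet tail under strong switching, never log-final.**
`Literature.Barriers.ResolutionOfSingularities.DimensionFourFrontier`. [cite: CossartPiltant2019, Rem. 3.2]
[cite: CutkoskyMourtada2019, Thm. 7.1] -/
theorem stub_eternalStallPhaseSSL : EternalStallPhaseSSL := by
  sorry

/-- **STUB (r13; FRONTIER) — Φ4ᴸˢ `EternalAlternationSSL`, the alternation under strong switching, never log-final.**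
`Literature.Barriers.ResolutionOfSingularities.DimensionFourFrontier`. [cite: HeinzerEtAl2015, Discussion 4.2]
[cite: CutkoskyMourtada2019, Thm. 7.1] -/
theorem stub_eternalAlternationSSL : EternalAlternationSSL := by
  sorry

/-- **STUB (r13; FRONTIER as a whole, with a PLAN of record on its rank-one part and a FACT DEBT on its rank-`≥ 2`
part at `n = 4`) — `NonSwitchingCore`.** [cite: HeinzerEtAl2015, Discussion 4.2] [cite: CossartPiltant2019, Thm. 1.1] -/
theorem stub_nonSwitchingCore : NonSwitchingCore := by
  sorry

/-- **CLOSED DOOR (p459384, `Theorems/WildConesIsolatedForcedTermination.lean`, door 1/27 of record).** The antecedent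
`IsolatedForcedTermination` is a theorem of the tree, cited by name: it feeds the dictionary inside the derivation of
R1-odd (`Sig.stub_core4LowMultOdd` carries no antecedent of its own). OURS. -/
theorem isolatedForcedTermination_closed : IsolatedForcedTermination :=
  Summit.ResolutionOfSingularities.ResolutionOfSingularities.Theorems.WildCones.IsolatedForcedTermination_proof

/-! ### r13 — the landed range cascade at ONE datum (the body of `Steer_of`, steps (2)–(8), as a lemma): a datum of
transcendence degree `n` along a zero-dimensional `O` over a perfect field either has a regular model by a LANDED
range theorem (Abhyankar place / discrete rank one / birational exit / base dimension `≤ 2` / unit derivative /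
dense-Abhyankar / strongly switching ∧ parameter-archimedean ∧ defectless) or satisfies ALL fourteen core binders.
This is what lets the composition re-base at an arbitrary generator (`GenRebase`) without transferring binders. -/

/-- **Concl ∨ CoreDatum** at one datum, by the landed ranges. Pure case analysis over tree theorems. OURS. [folklore] -/
theorem concl_or_coreDatum (p : ℕ) (hp : p.Prime) (n : ℕ) (k K : Type) [Field k] [CharP k p] [PerfectField k]
    [Field K] [Algebra k K] (O : ValuationSubring K) (A₀ : Subalgebra k K) (h₀ : A₀.toSubring ≤ O.toSubring)
    (t : K) (htr : Algebra.trdeg k K = (n : Cardinal)) (hzd : ZeroDim k O) (hfg : A₀.FG) (htp : t ^ p ∈ A₀)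
    (hfr : IsFractionRing (Algebra.adjoin k (insert t (A₀ : Set K))) K)
    (hreg : IsRegularLocalRing (Localization.AtPrime
      (Ideal.comap (Subring.inclusion h₀) (IsLocalRing.maximalIdeal O)))) :
    Concl O A₀ t ∨ CoreDatum p n k K O A₀ h₀ t := by
  classical
  -- Abhyankar places over a perfect ground field (KK05, landed)
  by_cases hA : IsAbhyankarPlace O (algebraMap k K).fieldRange ⊤
  · exact Or.inl (luAlphaPTorsor_of_isAbhyankarPlace_of_perfectField p hp k K O A₀ h₀ t hfg htp hfr hA)
  -- discrete rank one, every dimension (landed)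
  by_cases hD : Discrete O
  · exact Or.inl (luAlphaPTorsor_of_discrete p hp k K O A₀ h₀ t hfg htp hfr hreg hD)
  -- the birational exit: `t ^ p` is a `p`-th power at the centre (landed)
  by_cases hpow : ∃ c : Localization.AtPrime (Ideal.comap (Subring.inclusion h₀)
      (IsLocalRing.maximalIdeal O)), algebraMap A₀.toSubring (Localization.AtPrime
        (Ideal.comap (Subring.inclusion h₀) (IsLocalRing.maximalIdeal O))) ⟨t ^ p, htp⟩ = c ^ p
  · exact Or.inl (stub_birationalExit p hp k K O A₀ h₀ t hfg htp hfr hreg hpow)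
  push Not at hpow
  -- base dimension ≤ 2 at the centre (Giraud along ν, landed)
  by_cases hdim2 : ringKrullDim (Localization.AtPrime (Ideal.comap (Subring.inclusion h₀)
      (IsLocalRing.maximalIdeal O))) ≤ 2
  · exact Or.inl (luAlphaPTorsor_of_ringKrullDim_le_two p hp k K O A₀ h₀ t hfg htp hfr hreg hdim2)
  -- a unit ℤ-derivative of the radicand: the monogenic exit (landed)
  by_cases hδ : ∃ δ : Derivation ℤ (Localization.AtPrime (Ideal.comap (Subring.inclusion h₀)
      (IsLocalRing.maximalIdeal O))) (Localization.AtPrime (Ideal.comap (Subring.inclusion h₀)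
      (IsLocalRing.maximalIdeal O))), IsUnit (δ (algebraMap A₀.toSubring (Localization.AtPrime
        (Ideal.comap (Subring.inclusion h₀) (IsLocalRing.maximalIdeal O))) ⟨t ^ p, htp⟩))
  · exact Or.inl (luAlphaPTorsor_of_isUnit_derivation p hp k K O A₀ h₀ t hfg htp hfr hreg hδ)
  push Not at hδ
  -- `K` dense in a finitely generated Abhyankar subfunction field (KK09 Thm. 1.5, landed)
  by_cases hdense : DenseAbhyankar k O
  · exact Or.inl (denseRange3_crux p hp k K O A₀ h₀ t hfg htp hfr hzd hdense)
  -- the centre of a zero-dimensional valuation is a closed point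
  have hmax : (Ideal.comap (Subring.inclusion h₀) (IsLocalRing.maximalIdeal O)).IsMaximal :=
    isMaximal_centre_of_zeroDim O hzd A₀ h₀
  -- strongly switching ∧ parameter-archimedean ∧ defectless (this line's landed range)
  by_cases hS : StronglySwitching O A₀ ∧ ArchSeq O A₀ ∧ ¬ Defect O A₀ t p
  · exact Or.inl (stub_switchingDefectless p hp k K O A₀ h₀ t hfg htp hfr hreg hS.1 hS.2.1 hS.2.2)
  -- otherwise: the defect core, all binders in hand
  exact Or.inr ⟨hfg, htp, hfr, hreg, hmax, hzd, hdim2, hA, hdense, hD, hδ, hpow, htr, hS⟩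

/-! ### r13 — the composition of the phase machine (kernel-checked; no `sorry` of its own) -/

/-- **The whole dimension-`≥ 4` core at odd `p` at one datum from the phase machine** (SS cut with log-final exits;
the sub-plan's `concl_of_phasesSSL` with `Rebase` replaced by `GenRebase` + `concl_or_coreDatum`). Classical case
split along the point sequence `R`: not strongly switching ⇒ `NonSwitchingCore`; a log-final member ⇒ P1ᴸ; an exit
stage ⇒ P1; an eternal affine run from some generator at some stage ⇒ re-base there (P2⁰), then EITHER a landed range
concludes for the re-based datum OR it is a core datum with an eternal run, non-isolated infinitely often by the LANDED
dictionary (consuming the CLOSED door), hence `Concl` by the registered R2; a quiet tail ⇒ Φ3ᴸˢ (with P0 supplying the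
maximal generators); otherwise the hypotheses of Φ4ᴸˢ hold literally. Pure logic. OURS. [folklore] -/
theorem concl_of_phasesSSL (h0 : MaxGenExists) (hX : GenExit) (hL : LogExit) (hB : GenRebase)
    (hΦ3 : EternalStallPhaseSSL) (hΦ4 : EternalAlternationSSL) (hNS : NonSwitchingCore)
    (hD : Sig.stub_core4Dictionary) (hT : IsolatedForcedTermination) (hR2 : Sig.stub_core4EternalNonIsolated)
    (hCP : Sig.stub_cp2019General)
    (p : ℕ) (hp : p.Prime) (hp2 : p ≠ 2) (n : ℕ) (hn : 4 ≤ n) (hBelow : TorsorLUZeroDimBelow p n)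
    (k K : Type) [Field k] [CharP k p] [PerfectField k] [Field K] [Algebra k K]
    (O : ValuationSubring K) (A₀ : Subalgebra k K) (h₀ : A₀.toSubring ≤ O.toSubring) (t : K)
    (core : CoreDatum p n k K O A₀ h₀ t) (R : ℕ → Subring K) (hR0 : R 0 = locAtCentre A₀.toSubring O)
    (hRq : ∀ i, IsQuadraticTransformAlong O (R i) (R (i + 1))) : Concl O A₀ t := by
  classical
  -- r15: at `n = 4` a valuation WITH a proper coarsening is discharged by idea-1's landed composite-rank theorem
  -- (Cossart–Piltant Thm. 1.1 below and above the coarsening): the frontier residuals only see rank one at `n = 4`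
  by_cases hco : n = 4 ∧ HasProperCoarsening O
  · obtain ⟨hn4, hO⟩ := hco
    obtain ⟨hfg, htp, hfr, -, -, -, -, -, -, -, -, -, htr, -⟩ := core
    subst hn4
    have h4 : Algebra.trdeg k K ≤ 4 := by rw [htr]; exact_mod_cast le_refl 4
    exact concl_of_hasProperCoarsening hCP p hp.ne_zero h4 O hO A₀ h₀ t hfg htp hfr
  have hnc : n = 4 → ¬ HasProperCoarsening O := fun h4 hO => hco ⟨h4, hO⟩
  by_cases hss : StronglySwitching O A₀
  swap
  · exact hNS p hp hp2 n hn hBelow k K O A₀ h₀ t core hnc hss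
  by_cases hlog : ∃ M, LogExitAt (R M) p A₀ t
  · obtain ⟨M, hM⟩ := hlog
    exact hL p hp n hn k K O A₀ h₀ t core R hR0 hRq M hM
  by_cases hex : ∃ M, ExitAt (R M) p t
  · obtain ⟨M, hM⟩ := hex
    exact hX p hp n hn k K O A₀ h₀ t core R hR0 hRq M hM
  by_cases het : ∃ (M : ℕ) (s' : K) (R' : ℕ → Subring K) (u : ℕ → K), GenAt (R M) p t s' ∧
      R' 0 = R M ∧ (∀ i, IsQuadraticTransformAlong O (R' i) (R' (i + 1))) ∧ IsTorsorRun O R' s' p u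
  · obtain ⟨M, s', R', u, ⟨hsp, ht⟩, hR'0, hR'q, hrun⟩ := het
    obtain ⟨hfg, htp, hfr, hreg, -, hzd, -, -, -, -, -, -, htr, -⟩ := core
    obtain ⟨A', h', -, hRM, hfg', hsp', -, hfr', hreg', hpush⟩ :=
      hB p k K O A₀ h₀ t hfg htp hfr hreg R hR0 hRq M s' hsp ht
    rcases concl_or_coreDatum p hp n k K O A' h' s' htr hzd hfg' hsp' hfr' hreg' with hC | core'
    · exact hpush hC
    · obtain ⟨gfg, gtp, gfr, greg, gmax, gzd, gdim, gnA, gnd, gnD, gδ, gpow, gtr, gnS⟩ := core'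
      have hR'0' : R' 0 = locAtCentre A'.toSubring O := by rw [hR'0, hRM]
      exact hpush (hR2 p hp n hn hBelow k K O A' h' s' gfg gtp gfr greg gmax gzd gdim gnA gnd gnD gδ gpow gtr
        gnS R' hR'0' hR'q u hrun (hD hT p hp k K O A' h' s' gfg gtp gfr greg gzd R' hR'0' hR'q u hrun))
  by_cases hq : ∃ M₀ : ℕ, ∀ M, M₀ ≤ M → ¬ MultPAt O (R M) p t
  · obtain ⟨M₀, hM₀⟩ := hq
    push Not at hlog
    exact hΦ3 p hp hp2 n hn hBelow k K O A₀ h₀ t core hss hnc R hR0 hRq hlog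
      ⟨M₀, fun M hM => ⟨h0 p hp n hn k K O A₀ h₀ t core R hR0 hRq M, fun hM' => hex ⟨M, hM'⟩, hM₀ M hM⟩⟩
  · push Not at hq het hlog
    exact hΦ4 p hp hp2 n hn hBelow k K O A₀ h₀ t core hss hnc R hR0 hRq hlog (fun M hM => hex ⟨M, hM⟩) hq
      (fun M s' R' u hgen hR'0 hR'q hrun => het M s' R' u hgen hR'0 hR'q hrun)

/-- **R1-odd, DERIVED (r13)**: `Sig.stub_core4LowMultOdd` (registered r12 statement, verbatim) from the phase machine —
`stub_maxGenExists` (P0), `genExit_holds` (P1, LANDED), `stub_logExit` (P1ᴸ), `genRebase_holds` (P2⁰, LANDED),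
`stub_eternalStallPhaseSSL` (Φ3ᴸˢ), `stub_eternalAlternationSSL` (Φ4ᴸˢ), `stub_nonSwitchingCore`, the LANDED
`stub_switchingDefectless` / `stub_core4Dictionary`, the CLOSED door and the registered R2. The stalled run `(s, N)` of
the registered statement only certifies the regime — the machine restarts along `R`. [folklore] -/
theorem stub_core4LowMultOdd : Sig.stub_core4LowMultOdd := by
  intro p hp hp2 n hn hBelow k K _ _ _ _ _ O A₀ h₀ t hfg htp hfr hreg hmax hzd hdim2 hnA hnd hnD hδ hpow htr hnS
    R hR0 hRq _s _N _hsN _hns _hn1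
  exact concl_of_phasesSSL stub_maxGenExists genExit_holds stub_logExit genRebase_holds stub_eternalStallPhaseSSL
    stub_eternalAlternationSSL stub_nonSwitchingCore stub_core4Dictionary isolatedForcedTermination_closed
    stub_core4EternalNonIsolated stub_cp2019General p hp hp2 n hn hBelow k K O A₀ h₀ t
    ⟨hfg, htp, hfr, hreg, hmax, hzd, hdim2, hnA, hnd, hnD, hδ, hpow, htr, hnS⟩ R hR0 hRq

/-- The same derivation with idea-2's ONE statement `SeqLogFinalSS` in place of the two sharp residuals (the (α) heart
as one statement; not registered — recorded so that a proof of `SeqLogFinalSS` closes both Φ-stubs at once). -/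
theorem core4LowMultOdd_of_seqLogFinalSS (h0 : MaxGenExists) (hL : LogExit) (hS : SeqLogFinalSS)
    (hNS : NonSwitchingCore) (hR2 : Sig.stub_core4EternalNonIsolated) : Sig.stub_core4LowMultOdd := by
  intro p hp hp2 n hn hBelow k K _ _ _ _ _ O A₀ h₀ t hfg htp hfr hreg hmax hzd hdim2 hnA hnd hnD hδ hpow htr hnS
    R hR0 hRq _s _N _hsN _hns _hn1
  exact concl_of_phasesSSL h0 genExit_holds hL genRebase_holds (eternalStallPhaseSSL_of_seqLogFinalSS hS)
    (eternalAlternationSSL_of_seqLogFinalSS hS) hNS stub_core4Dictionary isolatedForcedTermination_closed hR2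
    stub_cp2019General p hp hp2 n hn hBelow k K O A₀ h₀ t
    ⟨hfg, htp, hfr, hreg, hmax, hzd, hdim2, hnA, hnd, hnD, hδ, hpow, htr, hnS⟩ R hR0 hRq

/-- **R1, DERIVED (r12)**: at `p = 2` by res-L0-w41-stub-2's landed `LowMult.core4LowMult_two` (p481401), at odd `p`
the phase machine (`stub_core4LowMultOdd`, derived in r13). [folklore] -/
theorem stub_core4LowMult : Sig.stub_core4LowMult :=
  fun p hp => if h2 : p = 2 then
    Summit.ResolutionOfSingularities.ResolutionOfSingularities.Theorems.SwitchingDichotomy.LowMult.core4LowMult_two p hp h2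
  else stub_core4LowMultOdd p hp h2

/-- **The r7 core from the five r8 stubs** — PROVED (pure logic): take the quadratic sequence and the greedy
torsor run (`stub_core4RunTrichotomy`); an eternal run is non-isolated infinitely often by the dictionary
(`stub_core4Dictionary`, the only consumer of `IsolatedForcedTermination`) and then `stub_core4EternalNonIsolated`
concludes; a run in order-one form exits (`stub_core4OrderOneExit`); a stalled run of cleaned order in
`[2, p - 1]` is `stub_core4LowMult`. [folklore] -/
theorem stub_steerDefectCore4_of (hR : Sig.stub_core4RunTrichotomy) (hD : Sig.stub_core4Dictionary)
    (hE : Sig.stub_core4OrderOneExit) (hL : Sig.stub_core4LowMult)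
    (hN : Sig.stub_core4EternalNonIsolated) : Sig.stub_steerDefectCore4 := by
  intro hT p hp n hn ih k K _ _ _ _ _ O A₀ h₀ t hfg htp hfr hreg hmax hzd hdim2 hnA hnd hnD hδ hpow htr hnS
  obtain ⟨R, hR0, hRq, htri⟩ := hR p k K O A₀ h₀ t htp hreg hdim2
  rcases htri with ⟨s, hs⟩ | ⟨s, N, hsN, h1⟩ | ⟨s, N, hsN, hns, hn1⟩
  · exact hN p hp n hn ih k K O A₀ h₀ t hfg htp hfr hreg hmax hzd hdim2 hnA hnd hnD hδ hpow htr hnS R hR0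
      hRq s hs (hD hT p hp k K O A₀ h₀ t hfg htp hfr hreg hzd R hR0 hRq s hs)
  · exact hE p hp k K O A₀ h₀ t hfg htp hfr hreg R hR0 hRq s N hsN h1
  · exact hL p hp n hn ih k K O A₀ h₀ t hfg htp hfr hreg hmax hzd hdim2 hnA hnd hnD hδ hpow htr hnS R hR0
      hRq s N hsN hns hn1

/-- The r7 open stub, now a THEOREM of the five r8 stubs (kept under its registered name so that `Steer_of`
and the landed `Steer_iff_steerDefectCore4_of_lu3` read unchanged). -/
theorem stub_steerDefectCore4 : Sig.stub_steerDefectCore4 :=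
  stub_steerDefectCore4_of stub_core4RunTrichotomy stub_core4Dictionary stub_core4OrderOneExit
    stub_core4LowMult stub_core4EternalNonIsolated

/-! ## The composition (kernel-checked; no `sorry` of its own) -/

/-- **`Steer` from the stub statements** — PROVED: zero-dimensional reduction (perfect `k` kept), then
strong induction on the transcendence degree `n`; `n ≤ 2`, Abhyankar places (perfect `k`), discrete
rank-one valuations, the birational exit, base dimension `≤ 2`, a unit derivative, the dense-Abhyankar
range (KK09 Thm. 1.5) and strongly-switching ∧ parameter-archimedean ∧ defectless are the tree's landed
theorems; the closed-point property of the centre comes from zero-dimensionality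
(`isMaximal_centre_of_zeroDim`); `n = 3` is local uniformization in dimension `≤ 3` over the perfect
ground field (`Sig.stub_lu3Perfect`, through `LocalUniformization3.relLocalUniformization` and
`exists_regularModel_of_relLocalUniformization`); what is left is exactly `Sig.stub_steerDefectCore4`. [folklore] -/
theorem Steer_of :
    Sig.stub_zeroDimPerfect → Sig.stub_switchingDefectless → Sig.stub_lu3Perfect → Sig.stub_steerDefectCore4 →
      Steer := by
  intro h1 h2 h3 hcore hT p hp
  apply h1 p hp
  suffices H : ∀ n : ℕ, ∀ (k K : Type) [Field k] [CharP k p] [PerfectField k] [Field K]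
      [Algebra k K] (O : ValuationSubring K) (A₀ : Subalgebra k K)
      (h₀ : A₀.toSubring ≤ O.toSubring) (t : K), Algebra.trdeg k K = (n : Cardinal) → ZeroDim k O →
      A₀.FG → t ^ p ∈ A₀ → IsFractionRing (Algebra.adjoin k (insert t (A₀ : Set K))) K →
      IsRegularLocalRing (Localization.AtPrime
        (Ideal.comap (Subring.inclusion h₀) (IsLocalRing.maximalIdeal O))) → Concl O A₀ t by
    intro k K _ _ _ _ _ O A₀ h₀ t hzd hfg htp hfr hreg
    obtain ⟨n, hn⟩ := exists_trdeg_eq_nat (Algebra.adjoin k (insert t (A₀ : Set K)))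
      (fg_adjoin_insert hfg t) hfr
    exact H n k K O A₀ h₀ t hn hzd hfg htp hfr hreg
  intro n
  induction n using Nat.strong_induction_on with
  | _ n IH =>
    intro k K _ _ _ _ _ O A₀ h₀ t htr hzd hfg htp hfr hreg
    -- (1) transcendence degree ≤ 2 (Giraud main induction, landed)
    by_cases hle : n ≤ 2
    · have h2' : Algebra.trdeg k K ≤ 2 := by rw [htr]; exact_mod_cast hle
      exact luAlphaPTorsor_of_trdeg_le_two p hp k K O A₀ h₀ t hfg htp hfr hreg h2'
    -- (1') transcendence degree 3: local uniformization in dimension ≤ 3 over the perfect ground field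
    --      (Cossart–Piltant; the fact-debt stub `stub_lu3Perfect`)
    by_cases h3n : n = 3
    · subst h3n
      have h3' : Algebra.trdeg k K ≤ 3 := by rw [htr]; exact_mod_cast le_refl 3
      exact exists_regularModel_of_relLocalUniformization O ((h3 p hp k).relLocalUniformization K h3' O)
        A₀ h₀ t hfg (mem_valuationSubring_of_pow_mem O hp.ne_zero (h₀ htp)) hfr
    have hn4 : 4 ≤ n := by omega
    -- (2) Abhyankar places over a perfect ground field (KK05, landed)
    by_cases hA : IsAbhyankarPlace O (algebraMap k K).fieldRange ⊤
    · exact luAlphaPTorsor_of_isAbhyankarPlace_of_perfectField p hp k K O A₀ h₀ t hfg htp hfr hA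
    -- (3) discrete rank one, every dimension (landed)
    by_cases hD : Discrete O
    · exact luAlphaPTorsor_of_discrete p hp k K O A₀ h₀ t hfg htp hfr hreg hD
    -- (4) the birational exit: `t ^ p` is a `p`-th power at the centre (landed)
    by_cases hpow : ∃ c : Localization.AtPrime (Ideal.comap (Subring.inclusion h₀)
        (IsLocalRing.maximalIdeal O)), algebraMap A₀.toSubring (Localization.AtPrime
          (Ideal.comap (Subring.inclusion h₀) (IsLocalRing.maximalIdeal O))) ⟨t ^ p, htp⟩ = c ^ p
    · exact stub_birationalExit p hp k K O A₀ h₀ t hfg htp hfr hreg hpow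
    push Not at hpow
    -- (5) base dimension ≤ 2 at the centre (Giraud along ν, landed)
    by_cases hdim2 : ringKrullDim (Localization.AtPrime (Ideal.comap (Subring.inclusion h₀)
        (IsLocalRing.maximalIdeal O))) ≤ 2
    · exact luAlphaPTorsor_of_ringKrullDim_le_two p hp k K O A₀ h₀ t hfg htp hfr hreg hdim2
    -- (6) a unit ℤ-derivative of the radicand: the monogenic exit (landed)
    by_cases hδ : ∃ δ : Derivation ℤ (Localization.AtPrime (Ideal.comap (Subring.inclusion h₀)
        (IsLocalRing.maximalIdeal O))) (Localization.AtPrime (Ideal.comap (Subring.inclusion h₀)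
        (IsLocalRing.maximalIdeal O))), IsUnit (δ (algebraMap A₀.toSubring (Localization.AtPrime
          (Ideal.comap (Subring.inclusion h₀) (IsLocalRing.maximalIdeal O))) ⟨t ^ p, htp⟩))
    · exact luAlphaPTorsor_of_isUnit_derivation p hp k K O A₀ h₀ t hfg htp hfr hreg hδ
    push Not at hδ
    -- (7) `K` dense in a finitely generated Abhyankar subfunction field (KK09 Thm. 1.5, landed)
    by_cases hdense : DenseAbhyankar k O
    · exact denseRange3_crux p hp k K O A₀ h₀ t hfg htp hfr hzd hdense
    -- the centre of a zero-dimensional valuation is a closed point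
    have hmax : (Ideal.comap (Subring.inclusion h₀) (IsLocalRing.maximalIdeal O)).IsMaximal :=
      isMaximal_centre_of_zeroDim O hzd A₀ h₀
    -- the induction hypothesis, repackaged
    have ih : TorsorLUZeroDimBelow p n := by
      intro k' K' _ _ _ _ _ O' A₀' h₀' t' hlt hzd' hfg' htp' hfr' hreg'
      obtain ⟨m, hm⟩ := exists_trdeg_eq_nat (Algebra.adjoin k' (insert t' (A₀' : Set K')))
        (fg_adjoin_insert hfg' t') hfr'
      have hmn : m < n := by rw [hm] at hlt; exact_mod_cast hlt
      exact IH m hmn k' K' O' A₀' h₀' t' hm hzd' hfg' htp' hfr' hreg'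
    -- (8) strongly switching ∧ parameter-archimedean ∧ defectless (this line's landed range)
    by_cases hS : StronglySwitching O A₀ ∧ ArchSeq O A₀ ∧ ¬ Defect O A₀ t p
    · exact h2 p hp k K O A₀ h₀ t hfg htp hfr hreg hS.1 hS.2.1 hS.2.2
    -- (9) the defect core
    · exact hcore hT p hp n hn4 ih k K O A₀ h₀ t hfg htp hfr hreg hmax hzd hdim2 hA hdense hD hδ
        hpow htr hS

/-- **The crux `Steer`, assembled from the registered stubs** (r8: the `sorry`s in its closure are exactly
`stub_lu3Perfect` — a fact debt —, the three PROVABLE stubs `stub_core4RunTrichotomy`, `stub_core4Dictionary`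
(the consumer of `IsolatedForcedTermination`), `stub_core4OrderOneExit`, and the two FRONTIER-class residuals
`stub_core4LowMult`, `stub_core4EternalNonIsolated` of the dimension-`≥ 4` core). -/
theorem Steer_proof : Steer :=
  Steer_of stub_zeroDimPerfect stub_switchingDefectless stub_lu3Perfect stub_steerDefectCore4

/-- **Given local uniformization in dimension `≤ 3` over perfect fields, `Steer` is EQUIVALENT to its
dimension-`≥ 4` defect core** (the converse instantiates the crux at the core's data, using the core's own
hypothesis `IsolatedForcedTermination`). [folklore] -/
theorem Steer_iff_steerDefectCore4_of_lu3 (h3 : Sig.stub_lu3Perfect) : Steer ↔ Sig.stub_steerDefectCore4 := by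
  refine ⟨fun h => ?_, Steer_of stub_zeroDimPerfect stub_switchingDefectless h3⟩
  intro hT p hp n _ _ k K _ _ _ _ _ O A₀ h₀ t hfg htp hfr hreg _ _ _ _ _ _ _ _ _ _
  exact h hT p hp k K O A₀ h₀ t hfg htp hfr hreg

/-- The dimension-`≥ 4` core is an instance of the crux outright (no fact needed). [folklore] -/
theorem stub_steerDefectCore4_of_steer (h : Steer) : Sig.stub_steerDefectCore4 := by
  intro hT p hp n _ _ k K _ _ _ _ _ O A₀ h₀ t hfg htp hfr hreg _ _ _ _ _ _ _ _ _ _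
  exact h hT p hp k K O A₀ h₀ t hfg htp hfr hreg

/-! ### r16 — the (α) heart at `n = 4` is SS ∧ RANK ONE ∧ DEFECT (kernel-visible for the strategists) -/

/-- **Rank one ⇒ archimedean on elements** (Hölder, through the tree's elementwise form
`CP2008.nonempty_rankOne_iff_archimedean`): if `O` admits a rank-one structure then for `x` of value `< 1` and
`y ≠ 0` some power `v(x) ^ n < v(y)`. [folklore] -/
theorem exists_pow_lt_of_rankOne {K : Type} [Field K] (O : ValuationSubring K)
    (hr : Nonempty O.valuation.RankOne) {x y : K} (hx : O.valuation x < 1) (hy : y ≠ 0) :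
    ∃ n : ℕ, O.valuation x ^ n < O.valuation y := by
  have hy' : 0 < O.valuation y := zero_lt_iff.mpr ((Valuation.ne_zero_iff _).mpr hy)
  by_cases hx0 : x = 0
  · exact ⟨1, by rw [hx0, map_zero, pow_one]; exact hy'⟩
  have hx' : 0 < O.valuation x := zero_lt_iff.mpr ((Valuation.ne_zero_iff _).mpr hx0)
  obtain ⟨-, harch⟩ :=
    (Literature.AlgebraicGeometry.CossartPiltant200819.CP2008.nonempty_rankOne_iff_archimedean O.valuation).mp hr
  have ha : 1 < O.valuation x⁻¹ := by
    rw [map_inv₀]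
    exact (one_lt_inv₀ hx').mpr hx
  obtain ⟨n, hn⟩ := harch x⁻¹ y⁻¹ ha
  rw [map_inv₀, map_inv₀, inv_pow, inv_le_inv₀ hy' (pow_pos hx' n)] at hn
  exact ⟨n + 1, lt_of_lt_of_le (pow_lt_pow_right_of_lt_one₀ hx' hx (Nat.lt_succ_self n)) hn⟩

/-- **The heart at `n = 4`.** For a core datum that is STRONGLY SWITCHING along a valuation ring WITHOUT a proper
coarsening (the only case the r15 frontier stubs see at `n = 4`), the valuation has rank one, hence the datum is
parameter-archimedean along the point sequence (`Theorems.SwitchingDichotomy.archSeq_of_arch`), hence — by the core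
binder `¬ (StronglySwitching ∧ ArchSeq ∧ ¬ Defect)` — it has DEFECT. So the registered residuals
`stub_eternalStallPhaseSSL` / `stub_eternalAlternationSSL` at `n = 4` are statements about rank-one DEFECT extensions
`T ^ p = t ^ p` of degree `p` (Kuhlmann's defect case) along strongly switching point sequences. OURS.
[cite: HeinzerEtAl2015, Remark 2.4] [cite: Kuhlmann2010Defect, §2] [folklore] -/
theorem archSeq_and_defect_of_not_hasProperCoarsening (p n : ℕ) (k K : Type) [Field k] [Field K] [Algebra k K]
    (O : ValuationSubring K) (A₀ : Subalgebra k K) (h₀ : A₀.toSubring ≤ O.toSubring) (t : K)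
    (core : CoreDatum p n k K O A₀ h₀ t) (hss : StronglySwitching O A₀) (hnc : ¬ HasProperCoarsening O) :
    ArchSeq O A₀ ∧ Defect O A₀ t p := by
  classical
  obtain ⟨-, -, -, hreg, -, -, hdim2, -, -, -, -, -, -, hnS⟩ := core
  -- the centre is non-zero, so `O ≠ ⊤`
  obtain ⟨a, haA, ha0, hva⟩ :=
    Summit.ResolutionOfSingularities.ResolutionOfSingularities.Theorems.SwitchingDichotomy.exists_mem_centre_of_not_ringKrullDim_le_two
      O A₀ h₀ hdim2
  have hO : O ≠ ⊤ := by
    intro hO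
    have hinv : O.valuation a⁻¹ ≤ 1 := (O.valuation_le_one_iff _).mpr (by rw [hO]; exact ValuationSubring.mem_top _)
    have h1 : O.valuation a * O.valuation a⁻¹ = 1 := by rw [← map_mul, mul_inv_cancel₀ ha0, map_one]
    have hlt : O.valuation a * O.valuation a⁻¹ < 1 * 1 :=
      mul_lt_mul_of_lt_of_le_of_nonneg_of_pos hva hinv zero_le zero_lt_one
    rw [h1, one_mul] at hlt
    exact lt_irrefl _ hlt
  have hr := rankOne_of_not_hasProperCoarsening O hO hnc
  -- rank one ⇒ archimedean on fractions ⇒ parameter-archimedean along the point sequence (tree)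
  have hArch : ArchSeq O A₀ :=
    Summit.ResolutionOfSingularities.ResolutionOfSingularities.Theorems.SwitchingDichotomy.archSeq_of_arch O A₀ h₀ hreg
      fun x y _ _ hy hx => exists_pow_lt_of_rankOne O hr hx hy
  refine ⟨hArch, ?_⟩
  by_contra hnd
  exact hnS ⟨hss, hArch, hnd⟩

/-- **(S) `NotCoarseningArchSeq`** (plan-1 g7's Sketch-R2-recut §5 statement, VERBATIM): along a valuation ring `O ≠ K`
WITHOUT proper coarsening the parameter-archimedean property `ArchSeq O A₀` holds for every finitely generated base regular
at the centre. PROVED below in-skeleton (r17). [cite: HeinzerEtAl2015, Remark 2.4] [folklore] -/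
def NotCoarseningArchSeq : Prop :=
  ∀ (k K : Type) [Field k] [Field K] [Algebra k K] (O : ValuationSubring K) (A₀ : Subalgebra k K)
    (h₀ : A₀.toSubring ≤ O.toSubring), O ≠ ⊤ → ¬ HasProperCoarsening O →
    IsRegularLocalRing (Localization.AtPrime
      (Ideal.comap (Subring.inclusion h₀) (IsLocalRing.maximalIdeal O))) →
    ArchSeq O A₀

/-- **PROVED (r17): the archimedean bridge** — rank one (`rankOne_of_not_hasProperCoarsening`) ⇒ archimedean on elements
(`exists_pow_lt_of_rankOne`) ⇒ `ArchSeq` (`Theorems.SwitchingDichotomy.archSeq_of_arch`). [cite: HeinzerEtAl2015, Remark 2.4]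
[folklore] -/
theorem notCoarseningArchSeq : NotCoarseningArchSeq := by
  intro k K _ _ _ O A₀ h₀ hO hnc hreg
  exact Summit.ResolutionOfSingularities.ResolutionOfSingularities.Theorems.SwitchingDichotomy.archSeq_of_arch O A₀ h₀
    hreg fun x y _ _ hy hx => exists_pow_lt_of_rankOne O (rankOne_of_not_hasProperCoarsening O hO hnc) hx hy

end Summit.ResolutionOfSingularities.ResolutionOfSingularities.Cruxes.Steer.Lines.SwitchingDichotomy
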